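import Literature.NumberTheory.Automorphic.AutomorphicRepsGLOneLine
import Literature.NumberTheory.Automorphic.ArchTranslateExpStable
import Literature.NumberTheory.Automorphic.AutomorphicRepsGLOneHeckeCharacter
import Literature.NumberTheory.Automorphic.AutomorphicFormsProofs
import Literature.NumberTheory.Automorphic.UnitaryGroupAutomorphicRep
import Literature.NumberTheory.Automorphic.GLnCentralCharacter
import Literature.NumberTheory.Automorphic.ArchExpIdeleGLOne
import Literature.NumberTheory.Automorphic.BaseChangeArchimedeanGLOneIdentities
import Literature.NumberTheory.Automorphic.UnitaryCoherentGaloisRepProofs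
import Literature.NumberTheory.GaloisRepresentations.HeckeCharacterValueFieldProofs
import HarnessLib

/-!
# Goldring–Koskivirta's Hecke-field finiteness in rank one: automorphic representations of the
# norm-one torus `U(1)_{K/F₀}`, their Hecke characters, and Weil's theorem (proved)

Topic `NumberTheory/Automorphic`; namespace `Literature.NumberTheory.Automorphic`. Proofs companion
(theorems, five auxiliary definitions, NO named fact, no instance; D-0026) of the named fact
`GoldringKoskivirta2019_heckeFieldFinite` (`UnitaryCoherentGaloisRep`): Goldring–Koskivirta,
*Strata Hasse invariants, Hecke algebras and Galois representations*, Invent. math. 217 (2019),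
Thm. 10.5.1 with §11.1, Case LDS (arXiv:1507.05032, p. 40, lines 30–34): the unramified Hecke
eigensystem of a cuspidal automorphic representation `σ` of Mok's quasi-split unitary group
`U_{K/F₀}(N)` which is a non-degenerate limit of discrete series at infinity takes, after `ι : ℚ̄_ℓ ≃ ℂ`,
values in ONE finite extension of `ℚ_ℓ`.

## Main result

* `GoldringKoskivirta2019_heckeFieldFinite_rank_one` — **the fact with `N := 1`, verbatim, proved**.
  For `N = 1` the unitary Shimura variety is `0`-dimensional and the printed input (integral
  coherent cohomology, Cor. 2.2.2) is elementary: `U_{K/F₀}(1) = U(1)` is the norm-one torus, its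
  archimedean points form the compact torus `(S¹)^d`, so EVERY automorphic representation of it is
  algebraic, and the statement is A. Weil's theorem (1956) that the values of a Hecke character of
  type `A₀` lie in a number field — through the dictionary "automorphic representations of `U(1)` ↔
  Hecke characters of `K` trivial on norms", in the direction representation ↦ character.

## The argument formalised (Borel–Jacquet model of the tree, `AutomorphicRepData`)

Let `E/F` be quadratic with non-trivial automorphism `c` (`c² = 1`), `π = W / W'` an automorphic
representation datum of `U(1)_{E/F}(𝔸_F) = {z ∈ 𝕀_E | z · c(z) = 1} ≤ GL₁(𝔸_E)`
(`UnitaryGroup.quasiSplitDatum F E c 1`).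

1. *Eigenvectors give scalars* (`AutomorphicRepData.forall_sub_smul_mem_of_exists`): an operator
   commuting with the `(𝔤, K_∞) × G(𝔸_f)`-action which has ONE eigenvector `φ₀ ∈ W ∖ W'` modulo `W'`
   acts by that scalar on all of `W / W'` (irreducibility; no countability or admissibility needed).
   The elements of `U(1)(𝔸_F)` acting by scalars form a subgroup `H_π` (`AutomorphicRepData.scalarSubgroup`)
   carrying a character `ω : H_π →* ℂˣ` (`exists_monoidHom_scalarSubgroup`).
2. *`U(1)` is abelian*: Hecke operators are single translations (`heckeOperator_rightTranslation_rank_one`),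
   the unramified eigenvalue is `β₀^{ord}` (`heckeEigenvalue_rank_one`), so a base-change Satake
   parameter at `u` is `{b}` with `r(t) φ ≡ b^{ord_u t} φ` for `t` supported over the place below `u`,
   and `b = 1` when `c • u = u` (`HasBaseChangeSatakeAt.rank_one`).
3. *Archimedean part*: `𝔲(1)` is abelian, stable spaces are `exp(tX)`-stable
   (`IsStableSubmodule.rightTranslation_ofArch_expMem_mem_rank_one`), `X` and `exp(tX)` act by scalars
   `d(X)` and `e^{t d(X)}` (`rightTranslation_ofArch_expMem_sub_exp_smul_mem_rank_one`, the tree's `GL₁`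
   argument of `AutomorphicRepsGLOneHeckeCharacter` verbatim).
4. *The Hecke character* (`AutomorphicRepData.exists_heckeCharacter_rank_one`): along
   `toNormOne : 𝕀_E → U(1)(𝔸_F)`, `z ↦ z · c(z)⁻¹`, the character `ω ∘ toNormOne` of
   `toNormOne⁻¹(H_π)` extends to all of `𝕀_E` because `ℂˣ` is divisible (Baer;
   `MonoidHom.exists_extend_unitsComplex`); the extension `ψ` is trivial on `Eˣ` (rational points of
   `U(1)` act trivially: left invariance + commutativity), trivial on an open subgroup of finite
   idèles (level of a form), and has archimedean slices `Y ↦ ψ(g₀) e^{d(Y - (c ⊗ 1)Y)}`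
   (`toNormOne_det_ofInfinite_expGL`: `z / c(z) = exp(Y - (c ⊗ 1) Y)` for `z = det(exp Y, 1)`), hence is
   continuous (`continuousAt_of_continuousAt_archSlice`): a `HeckeCharacter E`.
5. *Algebraicity* (`heckeCharacter_isAlgebraic_rank_one`): when `E` is totally complex and `c ≠ 1` fixes
   the complex places (automatic for `F` totally real, `smul_infinitePlace_eq_of_isComplex`), `c ⊗ 1` is
   complex conjugation on each factor (`map_conjMixed_complexPlaceLie`), periodicity of `exp` on `𝔲(1)`
   makes `d` integral, and `ψ((x,1)) = ∏_w ι_w(x_w)^{n_w} \overline{ι_w(x_w)}^{-n_w}`: type `A₀`.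
6. *Values* (`isUnramifiedAt_and_eq_valueAtUniformizer_of_hasBaseChangeSatakeAt`): at a good split `u`
   the Satake parameter is `{ψ(ϖ_u)}` and `ψ` is unramified at `u`; Weil's theorem
   (`HeckeCharacter.IsAlgebraic.exists_intermediateField_valueAtUniformizer_mem`, proved in the tree)
   puts all these values in one number field `L ⊂ ℂ`, and
   `exists_finiteDimensional_coeff_arithFrobPolyOfSatake_mem` (`UnitaryCoherentGaloisRepProofs`) passes to
   one finite `E/ℚ_ℓ`.

Auxiliary definitions (real, with API): `UnitaryGroup.conjIdele` (`c ⊗ 1` on `𝕀_E`),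
`UnitaryGroup.toNormOne` (`z ↦ z/c(z)`), `AutomorphicRepData.ActsByScalar`,
`AutomorphicRepData.scalarSubgroup`, `UnitaryGroup.archLog` (`Y ↦ Y - (c ⊗ 1)Y : 𝔤𝔩₁(E ⊗ ℝ) → 𝔲(1)`).
What is NOT here: the fact for `N ≥ 2` (coherent cohomology of unitary Shimura varieties and its
integral structure — no part of which is in Mathlib or the tree), the surjectivity of `toNormOne`
(Hilbert 90, not needed), and the converse direction character ↦ representation.

## References

* W. Goldring, J.-S. Koskivirta, Invent. math. 217 (2019), Thm. 10.5.1, §11.1, Cor. 2.2.2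
  [GoldringKoskivirta2019].
* A. Weil, *On a certain type of characters of the idèle-class group of an algebraic number-field*,
  Tokyo–Nikko 1955 (1956), §1 [Weil1956].
* S. Gelbart, *Automorphic forms on adele groups*, Ann. of Math. Stud. 83 (1975), §2.A, §6.A [Gelbart1975].
* A. Borel, H. Jacquet, Corvallis (1979), Part 1, §4.1–4.6 [BorelJacquet1979].
* C. P. Mok, Mem. AMS 235 (2015) = arXiv:1206.0882, §1 Notation, §2.1–2.2, Thm. 2.5.1 [Mok2014].
* J. Tate, *Global class field theory*, in Cassels–Fröhlich (1967), Ch. VII §1.1 [CasselsFrohlichANT1967].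
-/

noncomputable section

-- Mathlib idiom (Mathlib/Algebra/Lie/OfAssociative.lean); needed to mention Lie subalgebras of matrix algebras
attribute [local instance 100] LieRing.ofAssociativeRing

open scoped MatrixGroups Matrix Classical
open NumberField NumberField.mixedEmbedding IsDedekindDomain NormedSpace
open Literature.NumberTheory.GaloisRepresentations (ideleGroup localUnits principalIdeles infiniteIdeles
  localUnits_fst finiteAdeleSingle finiteAdeleSingle_apply_self finiteAdeleSingle_apply_of_ne)

namespace Literature.NumberTheory.Automorphic

section EigenvectorToScalar

variable {K : Type} [Field K] [NumberField K]
  {A : Type*} [NormedCommRing A] [NormedAlgebra ℝ A] [NormedAlgebra ℚ A] [CompleteSpace A]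
  [StarRing A] {N : Type*} [Fintype N] [DecidableEq N]
  {𝒢 : AdelicGroupData K} {𝒟 : AutomorphyDatum 𝒢 A N}

/-- **An eigenvector modulo `W'` makes the operator a scalar modulo `W'`.** Let `π = W / W'` be an
automorphic representation datum and `T` an operator on functions mapping `W` to `W` and `W'` to
`W'`, additive and homogeneous on `W`, commuting on `W` with the right translations by `G(𝔸_f)` and
`K_∞` and with the Lie derivatives. If some `φ₀ ∈ W ∖ W'` satisfies `T φ₀ - c φ₀ ∈ W'`, then
`T φ - c φ ∈ W'` for every `φ ∈ W`: the subspace `{ψ ∈ W | T ψ - c ψ ∈ W'}` is stable and contains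
`W'` and `φ₀ ∉ W'`, hence is `W` by irreducibility (the injectivity half of Schur's lemma modulo
`W'`, `AutomorphicRepData.exists_forall_sub_smul_mem_of_comm`, which needs no countability).
Borel–Jacquet 1979, 4.6; Getz–Hahn 2024, §4.5, Lemma 4.1. [folklore] -/
theorem AutomorphicRepData.forall_sub_smul_mem_of_exists [FiniteDimensional ℝ A]
    (π : AutomorphicRepData 𝒟) (T : (𝒢.Adelic → ℂ) → (𝒢.Adelic → ℂ))
    (hTW : ∀ φ ∈ π.W, T φ ∈ π.W) (hTW' : ∀ φ ∈ π.W', T φ ∈ π.W')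
    (hadd : ∀ φ ∈ π.W, ∀ ψ ∈ π.W, T (φ + ψ) = T φ + T ψ)
    (hsmul : ∀ (a : ℂ), ∀ φ ∈ π.W, T (a • φ) = a • T φ)
    (hfin : ∀ h ∈ 𝒟.finiteAdelic, ∀ φ ∈ π.W,
      T (rightTranslation 𝒢 h φ) = rightTranslation 𝒢 h (T φ))
    (hk : ∀ (k : 𝒟.arch.maximalCompact), ∀ φ ∈ π.W,
      T (rightTranslation 𝒢 (𝒟.ofK k) φ) = rightTranslation 𝒢 (𝒟.ofK k) (T φ))
    (hlie : ∀ (X : 𝒟.arch.lie), ∀ φ ∈ π.W,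
      T (lieDeriv 𝒟.ofArch X φ) = lieDeriv 𝒟.ofArch X (T φ))
    {c : ℂ} {φ₀ : 𝒢.Adelic → ℂ} (hφ₀ : φ₀ ∈ π.W) (hφ₀' : φ₀ ∉ π.W')
    (h₀ : T φ₀ - c • φ₀ ∈ π.W') :
    ∀ φ ∈ π.W, T φ - c • φ ∈ π.W' := by
  have hsmooth : ∀ φ ∈ π.W, IsArchSmooth 𝒟.ofArch φ := fun φ h => π.stable.isArchSmooth h
  have hle : π.W' ≤ π.W := π.lt.le
  have hT0 : T 0 = 0 := by simpa using hsmul 0 0 π.W.zero_mem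
  have hXsub : ∀ (X : 𝒟.arch.lie), ∀ φ ∈ π.W, ∀ ψ ∈ π.W, ∀ (a : ℂ),
      lieDeriv 𝒟.ofArch X (φ - a • ψ) = lieDeriv 𝒟.ofArch X φ - a • lieDeriv 𝒟.ofArch X ψ := by
    intro X φ hφ ψ hψ a
    rw [sub_eq_add_neg, ← neg_smul,
      IsArchSmooth.lieDeriv_add 𝒟.ofArch X (hsmooth φ hφ) ((hsmooth ψ hψ).smul 𝒟.ofArch (-a)),
      lieDeriv_smul, neg_smul, ← sub_eq_add_neg]
  let E : Submodule ℂ (𝒢.Adelic → ℂ) :=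
    { carrier := {ψ | ψ ∈ π.W ∧ T ψ - c • ψ ∈ π.W'}
      zero_mem' := ⟨π.W.zero_mem, by rw [hT0, smul_zero, sub_zero]; exact π.W'.zero_mem⟩
      add_mem' := fun {a b} ha hb => ⟨π.W.add_mem ha.1 hb.1, by
        rw [hadd a ha.1 b hb.1, smul_add, add_sub_add_comm]
        exact π.W'.add_mem ha.2 hb.2⟩
      smul_mem' := fun a ψ hψ => ⟨π.W.smul_mem a hψ.1, by
        rw [hsmul a ψ hψ.1, smul_comm, ← smul_sub]
        exact π.W'.smul_mem a hψ.2⟩ }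
  have hEW : E ≤ π.W := fun ψ h => h.1
  have hW'E : π.W' ≤ E := fun ψ h => ⟨hle h, π.W'.sub_mem (hTW' ψ h) (π.W'.smul_mem c h)⟩
  have hEst : IsStableSubmodule 𝒟 E :=
    { le_automorphicForms := hEW.trans π.stable.le_automorphicForms
      finite_stable := fun h hh ψ hψ => ⟨π.stable.finite_stable h hh hψ.1, by
        rw [hfin h hh ψ hψ.1, ← map_smul, ← map_sub]
        exact π.stable'.finite_stable h hh hψ.2⟩
      k_stable := fun k ψ hψ => ⟨π.stable.k_stable k hψ.1, by
        rw [hk k ψ hψ.1, ← map_smul, ← map_sub]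
        exact π.stable'.k_stable k hψ.2⟩
      lie_stable := fun X ψ hψ => ⟨π.stable.lie_stable X ψ hψ.1, by
        rw [hlie X ψ hψ.1, ← hXsub X (T ψ) (hTW ψ hψ.1) ψ hψ.1 c]
        exact π.stable'.lie_stable X _ hψ.2⟩ }
  rcases π.irreducible E hW'E hEW hEst with h | h
  · have hmem : φ₀ ∈ E := ⟨hφ₀, h₀⟩
    rw [h] at hmem
    exact absurd hmem hφ₀'
  · intro φ hφ
    have hmem : φ ∈ E := by rw [h]; exact hφ
    exact hmem.2

/-- **Right translations: an eigenvector modulo `W'` makes `r(g)` a scalar modulo `W'`**, for any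
`g ∈ G(𝔸_K)` whose right translation preserves `W` and `W'` and which commutes with `G(𝔸_f)`, with
`K_∞` and (through its right translation) with the Lie derivatives — e.g. every element of a
commutative group. [folklore] -/
theorem AutomorphicRepData.forall_rightTranslation_sub_smul_mem_of_exists [FiniteDimensional ℝ A]
    (π : AutomorphicRepData 𝒟) (g : 𝒢.Adelic)
    (hgW : ∀ φ ∈ π.W, rightTranslation 𝒢 g φ ∈ π.W) (hgW' : ∀ φ ∈ π.W', rightTranslation 𝒢 g φ ∈ π.W')
    (hfin : ∀ h ∈ 𝒟.finiteAdelic, h * g = g * h)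
    (hk : ∀ (k : 𝒟.arch.maximalCompact), 𝒟.ofK k * g = g * 𝒟.ofK k)
    (hlie : ∀ (X : 𝒟.arch.lie) (φ : 𝒢.Adelic → ℂ),
      rightTranslation 𝒢 g (lieDeriv 𝒟.ofArch X φ) = lieDeriv 𝒟.ofArch X (rightTranslation 𝒢 g φ))
    {c : ℂ} {φ₀ : 𝒢.Adelic → ℂ} (hφ₀ : φ₀ ∈ π.W) (hφ₀' : φ₀ ∉ π.W')
    (h₀ : rightTranslation 𝒢 g φ₀ - c • φ₀ ∈ π.W') :
    ∀ φ ∈ π.W, rightTranslation 𝒢 g φ - c • φ ∈ π.W' := by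
  refine π.forall_sub_smul_mem_of_exists (rightTranslation 𝒢 g) hgW hgW'
    (fun φ _ ψ _ => map_add _ φ ψ) (fun a φ _ => map_smul _ a φ) (fun h hh φ _ => ?_)
    (fun k φ _ => ?_) (fun X φ _ => hlie X φ) hφ₀ hφ₀' h₀
  · rw [← Module.End.mul_apply, ← map_mul, (hfin h hh).symm, map_mul, Module.End.mul_apply]
  · rw [← Module.End.mul_apply, ← map_mul, (hk k).symm, map_mul, Module.End.mul_apply]

end EigenvectorToScalar

/-! ### Characters extend: `ℂˣ` is divisible -/

section Extension

/-- `z ↦ z ^ n` is onto `ℂˣ` for `n ≠ 0` (`ℂ` is algebraically closed). [folklore] -/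
theorem Complex.units_zpow_surjective {n : ℤ} (hn : n ≠ 0) :
    Function.Surjective (fun z : ℂˣ => z ^ n) := by
  have hpos : 0 < n.natAbs := Int.natAbs_pos.2 hn
  have key : ∀ w : ℂˣ, ∃ z : ℂˣ, z ^ (n.natAbs : ℤ) = w := by
    intro w
    obtain ⟨z, hz⟩ := IsAlgClosed.exists_pow_nat_eq (w : ℂ) hpos
    have hz0 : z ≠ 0 := by
      rintro rfl
      rw [zero_pow hpos.ne'] at hz
      exact w.ne_zero hz.symm
    refine ⟨Units.mk0 z hz0, Units.ext ?_⟩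
    rw [zpow_natCast, Units.val_pow_eq_pow_val, Units.val_mk0, hz]
  intro w
  rcases Int.natAbs_eq n with h | h
  · obtain ⟨z, hz⟩ := key w
    exact ⟨z, by rw [h]; exact hz⟩
  · obtain ⟨z, hz⟩ := key w⁻¹
    refine ⟨z, ?_⟩
    change z ^ n = w
    rw [h, zpow_neg, hz, inv_inv]

/-- **Characters with values in `ℂˣ` extend from subgroups of commutative groups**: `ℂˣ` is a
divisible abelian group, hence an injective `ℤ`-module (Baer; Mathlib `Module.Baer.of_divisible`,
`Module.Baer.extension_property_addMonoidHom`). [folklore] -/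
theorem MonoidHom.exists_extend_unitsComplex {G : Type*} [CommGroup G] (H : Subgroup G)
    (f : H →* ℂˣ) : ∃ F : G →* ℂˣ, ∀ h : H, F h = f h := by
  letI : DivisibleBy (Additive ℂˣ) ℤ := divisibleByOfSMulRightSurj _ _ fun {n} hn => by
    intro a
    obtain ⟨z, hz⟩ := Complex.units_zpow_surjective hn (Additive.toMul a)
    exact ⟨Additive.ofMul z, by
      apply Additive.toMul.injective
      simpa using hz⟩
  have hB : Module.Baer ℤ (Additive ℂˣ) := Module.Baer.of_divisible _
  obtain ⟨h, hh⟩ := hB.extension_property_addMonoidHom (MonoidHom.toAdditive H.subtype)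
    (fun x y hxy => by simpa using hxy) (MonoidHom.toAdditive f)
  refine ⟨MonoidHom.toAdditive.symm h, fun x => ?_⟩
  have hx := congrArg (fun φ : Additive H →+ Additive ℂˣ => Additive.toMul (φ (Additive.ofMul x))) hh
  simpa using hx

end Extension

/-! ### The subgroup of elements acting by scalars, and its character -/

section ScalarSubgroup

variable {K : Type} [Field K] [NumberField K]
  {A : Type*} [NormedCommRing A] [NormedAlgebra ℝ A] [NormedAlgebra ℚ A] [CompleteSpace A]
  [StarRing A] {N : Type*} [Fintype N] [DecidableEq N]
  {𝒢 : AdelicGroupData K} {𝒟 : AutomorphyDatum 𝒢 A N}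

namespace AutomorphicRepData

/-- `g ∈ G(𝔸_K)` **acts by a scalar on** `π = W / W'`: `r(g)` preserves `W` and `W'`, and
`r(g) φ - a φ ∈ W'` for all `φ ∈ W`, for some `a ∈ ℂ`. [folklore] -/
def ActsByScalar (π : AutomorphicRepData 𝒟) (g : 𝒢.Adelic) : Prop :=
  (∀ φ ∈ π.W, rightTranslation 𝒢 g φ ∈ π.W) ∧ (∀ φ ∈ π.W', rightTranslation 𝒢 g φ ∈ π.W') ∧
    ∃ a : ℂ, ∀ φ ∈ π.W, rightTranslation 𝒢 g φ - a • φ ∈ π.W'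

/-- `1` acts by the scalar `1`. [folklore] -/
theorem actsByScalar_one (π : AutomorphicRepData 𝒟) : π.ActsByScalar 1 :=
  ⟨fun φ hφ => by rwa [map_one, Module.End.one_apply],
    fun φ hφ => by rwa [map_one, Module.End.one_apply],
    1, fun φ _ => by rw [map_one, Module.End.one_apply, one_smul, sub_self]; exact π.W'.zero_mem⟩

/-- Products of elements acting by scalars act by (the product of) the scalars. [folklore] -/
theorem ActsByScalar.mul {π : AutomorphicRepData 𝒟} {g h : 𝒢.Adelic} (hg : π.ActsByScalar g)
    (hh : π.ActsByScalar h) : π.ActsByScalar (g * h) := by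
  obtain ⟨hgW, hgW', a, ha⟩ := hg
  obtain ⟨hhW, hhW', b, hb⟩ := hh
  refine ⟨fun φ hφ => ?_, fun φ hφ => ?_, a * b, fun φ hφ => ?_⟩
  · rw [map_mul, Module.End.mul_apply]; exact hgW _ (hhW φ hφ)
  · rw [map_mul, Module.End.mul_apply]; exact hgW' _ (hhW' φ hφ)
  · have h1 : rightTranslation 𝒢 g (rightTranslation 𝒢 h φ - b • φ) ∈ π.W' := hgW' _ (hb φ hφ)
    have h2 : b • (rightTranslation 𝒢 g φ - a • φ) ∈ π.W' := π.W'.smul_mem b (ha φ hφ)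
    have h12 := π.W'.add_mem h1 h2
    rw [map_mul, Module.End.mul_apply]
    convert h12 using 1
    rw [map_sub, map_smul, smul_sub, smul_smul, mul_comm a b]
    abel

/-- The **subgroup of `G(𝔸_K)` acting by scalars on `W / W'`**: the elements `g` such that `g`
and `g⁻¹` both act by scalars (`ActsByScalar`). [folklore] -/
def scalarSubgroup (π : AutomorphicRepData 𝒟) : Subgroup 𝒢.Adelic where
  carrier := {g | π.ActsByScalar g ∧ π.ActsByScalar g⁻¹}
  one_mem' := ⟨π.actsByScalar_one, by rw [inv_one]; exact π.actsByScalar_one⟩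
  mul_mem' := fun {g h} hg hh => ⟨hg.1.mul hh.1, by rw [mul_inv_rev]; exact hh.2.mul hg.2⟩
  inv_mem' := fun {g} hg => ⟨hg.2, by rw [inv_inv]; exact hg.1⟩

/-- Membership in `scalarSubgroup` (definitional). [folklore] -/
theorem mem_scalarSubgroup_iff (π : AutomorphicRepData 𝒟) (g : 𝒢.Adelic) :
    g ∈ π.scalarSubgroup ↔ π.ActsByScalar g ∧ π.ActsByScalar g⁻¹ :=
  Iff.rfl

/-- **The character of the scalar subgroup**: there is a homomorphism `ω : H_π →* ℂˣ` on the
subgroup `H_π` of elements acting by scalars such that `r(g) φ - ω(g) φ ∈ W'` for all `g ∈ H_π`,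
`φ ∈ W` (the scalar of `g` is non-zero since `g⁻¹` preserves `W'`, is unique, and is
multiplicative by uniqueness). Borel–Jacquet 1979, 4.6; Gelbart 1975, §2.A. [folklore] -/
theorem exists_monoidHom_scalarSubgroup (π : AutomorphicRepData 𝒟) :
    ∃ ω : π.scalarSubgroup →* ℂˣ, ∀ (g : π.scalarSubgroup), ∀ φ ∈ π.W,
      rightTranslation 𝒢 (g : 𝒢.Adelic) φ - ((ω g : ℂˣ) : ℂ) • φ ∈ π.W' := by
  obtain ⟨φ₀, hφ₀W, hφ₀W'⟩ := SetLike.exists_of_lt π.lt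
  have hex : ∀ g : π.scalarSubgroup, ∃ a : ℂ, ∀ φ ∈ π.W,
      rightTranslation 𝒢 (g : 𝒢.Adelic) φ - a • φ ∈ π.W' := fun g => g.2.1.2.2
  choose a ha using hex
  have huniq : ∀ (g : π.scalarSubgroup) (b : ℂ),
      rightTranslation 𝒢 (g : 𝒢.Adelic) φ₀ - b • φ₀ ∈ π.W' → b = a g :=
    fun g b hb => eq_of_sub_smul_mem_of_not_mem hb (ha g φ₀ hφ₀W) hφ₀W'
  have hne : ∀ g, a g ≠ 0 := by
    intro g h0
    have h1 := ha g φ₀ hφ₀W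
    rw [h0, zero_smul, sub_zero] at h1
    have h2 : rightTranslation 𝒢 (g : 𝒢.Adelic)⁻¹ (rightTranslation 𝒢 (g : 𝒢.Adelic) φ₀) ∈ π.W' :=
      g.2.2.2.1 _ h1
    rw [← Module.End.mul_apply, ← map_mul, inv_mul_cancel, map_one, Module.End.one_apply] at h2
    exact hφ₀W' h2
  have h1 : a 1 = 1 := (huniq 1 1 (by
    rw [OneMemClass.coe_one, map_one, Module.End.one_apply, one_smul, sub_self]
    exact π.W'.zero_mem)).symm
  have hmul : ∀ g h, a (g * h) = a g * a h := by
    intro g h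
    refine (huniq (g * h) (a g * a h) ?_).symm
    have hA := ha g _ (h.2.1.1 φ₀ hφ₀W)
    have hB := π.W'.smul_mem (a g) (ha h φ₀ hφ₀W)
    have hAB := π.W'.add_mem hA hB
    rw [Subgroup.coe_mul, map_mul, Module.End.mul_apply]
    convert hAB using 1
    rw [smul_sub, smul_smul]
    abel
  exact ⟨{ toFun := fun g => Units.mk0 (a g) (hne g)
           map_one' := Units.ext h1
           map_mul' := fun g h => Units.ext (hmul g h) }, fun g φ hφ => ha g φ hφ⟩

/-- Elements acting trivially on `W` lie in the scalar subgroup. [folklore] -/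
theorem mem_scalarSubgroup_of_forall_eq (π : AutomorphicRepData 𝒟) {g : 𝒢.Adelic}
    (h : ∀ φ ∈ π.W, rightTranslation 𝒢 g φ = φ) : g ∈ π.scalarSubgroup := by
  have h' : ∀ φ ∈ π.W, rightTranslation 𝒢 g⁻¹ φ = φ := fun φ hφ => by
    conv_lhs => rw [← h φ hφ]
    rw [← Module.End.mul_apply, ← map_mul, inv_mul_cancel, map_one, Module.End.one_apply]
  have key : ∀ g' : 𝒢.Adelic, (∀ φ ∈ π.W, rightTranslation 𝒢 g' φ = φ) → π.ActsByScalar g' :=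
    fun g' hg' => ⟨fun φ hφ => by rw [hg' φ hφ]; exact hφ,
      fun φ hφ => by rw [hg' φ (π.lt.le hφ)]; exact hφ,
      1, fun φ hφ => by rw [hg' φ hφ, one_smul, sub_self]; exact π.W'.zero_mem⟩
  exact ⟨key g h, key g⁻¹ h'⟩

/-- An element acting by a scalar whose inverse preserves `W` and `W'` lies in the scalar subgroup
(the scalar `a` is non-zero and `g⁻¹` acts by `a⁻¹`). [folklore] -/
theorem mem_scalarSubgroup_of_actsByScalar (π : AutomorphicRepData 𝒟) {g : 𝒢.Adelic}
    (hg : π.ActsByScalar g) (hW : ∀ φ ∈ π.W, rightTranslation 𝒢 g⁻¹ φ ∈ π.W)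
    (hW' : ∀ φ ∈ π.W', rightTranslation 𝒢 g⁻¹ φ ∈ π.W') : g ∈ π.scalarSubgroup := by
  obtain ⟨φ₀, hφ₀W, hφ₀W'⟩ := SetLike.exists_of_lt π.lt
  obtain ⟨hgW, hgW', a, ha⟩ := hg
  have ha0 : a ≠ 0 := by
    intro h0
    have h1 := ha φ₀ hφ₀W
    rw [h0, zero_smul, sub_zero] at h1
    have h2 := hW' _ h1
    rw [← Module.End.mul_apply, ← map_mul, inv_mul_cancel, map_one, Module.End.one_apply] at h2
    exact hφ₀W' h2
  refine ⟨⟨hgW, hgW', a, ha⟩, hW, hW', a⁻¹, fun φ hφ => ?_⟩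
  have h1 : rightTranslation 𝒢 g⁻¹ (rightTranslation 𝒢 g φ - a • φ) ∈ π.W' := hW' _ (ha φ hφ)
  rw [map_sub, map_smul, ← Module.End.mul_apply, ← map_mul, inv_mul_cancel, map_one,
    Module.End.one_apply] at h1
  have h2 := π.W'.smul_mem (-a⁻¹) h1
  convert h2 using 1
  rw [smul_sub, smul_smul, neg_mul, inv_mul_cancel₀ ha0, neg_smul, neg_smul, one_smul]
  abel

/-- The value of the character of the scalar subgroup is read off any `φ₀ ∈ W ∖ W'`. [folklore] -/
theorem scalar_eq_of_sub_smul_mem (π : AutomorphicRepData 𝒟) {ω : π.scalarSubgroup →* ℂˣ}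
    (hω : ∀ (g : π.scalarSubgroup), ∀ φ ∈ π.W,
      rightTranslation 𝒢 (g : 𝒢.Adelic) φ - ((ω g : ℂˣ) : ℂ) • φ ∈ π.W')
    {g : 𝒢.Adelic} (hg : g ∈ π.scalarSubgroup) {φ₀ : 𝒢.Adelic → ℂ} (hφ₀ : φ₀ ∈ π.W)
    (hφ₀' : φ₀ ∉ π.W') {a : ℂ} (ha : rightTranslation 𝒢 g φ₀ - a • φ₀ ∈ π.W') :
    ((ω ⟨g, hg⟩ : ℂˣ) : ℂ) = a :=
  eq_of_sub_smul_mem_of_not_mem (hω ⟨g, hg⟩ φ₀ hφ₀) ha hφ₀'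

end AutomorphicRepData

end ScalarSubgroup

/-- The entries of a scalar `1 × 1` invertible matrix. [folklore] -/
theorem GeneralLinearGroup.scalar_fin_one_val_apply {R : Type*} [CommRing R] (u : Rˣ) (i j : Fin 1) :
    (Matrix.GeneralLinearGroup.scalar (Fin 1) u).val i j = (u : R) := by
  rw [Subsingleton.elim i 0, Subsingleton.elim j 0]
  simp [Matrix.scalar_apply]

namespace UnitaryGroup

variable (F E : Type) [Field F] [NumberField F] [Field E] [NumberField E] [Algebra F E]
  (c : E ≃ₐ[F] E)

/-- **`U(1)_{E/F}(𝔸_F)` is commutative** (it sits in `GL₁(𝔸_E)`; the tree's `GL_fin_one_mul_comm`). [folklore] -/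
theorem mul_comm_rank_one (g h : (quasiSplit F E c 1).Adelic) : g * h = h * g :=
  Subtype.ext (GL_fin_one_mul_comm (adelicVal F E c 1 _ g) (adelicVal F E c 1 _ h))

variable {F E c} in
omit [NumberField F] in
/-- `(c ⊗ 1)² = 1` on `𝔸_E` for an involution `c` (the tree's `conjAdele_conjAdele` of
`UnitaryGroupGlobalGenericity`, re-proved privately to keep this file's imports small). [folklore] -/
private theorem conjAdele_conjAdele' (hc : c * c = 1) (x : AdeleRing (𝓞 E) E) :
    conjAdele F E c (conjAdele F E c x) = x := by
  rw [conjAdele_apply, conjAdele_apply, smul_smul, hc, one_smul]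

/-- The conjugation `c ⊗ 1` on the idèles `𝕀_E = 𝔸_Eˣ` (`Units.map` of `conjAdele`). [folklore] -/
def conjIdele : ideleGroup E →* ideleGroup E :=
  Units.map (conjAdele F E c : AdeleRing (𝓞 E) E →+* AdeleRing (𝓞 E) E).toMonoidHom

omit [NumberField F] in
/-- `conjIdele` on underlying adèles is `c • ·` (definitional). [folklore] -/
@[simp] theorem coe_conjIdele (z : ideleGroup E) :
    ((conjIdele F E c z : ideleGroup E) : AdeleRing (𝓞 E) E) = c • (z : AdeleRing (𝓞 E) E) := rfl

variable {F E c} in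
omit [NumberField F] in
/-- `conjIdele` is an involution when `c` is. [folklore] -/
theorem conjIdele_conjIdele (hc : c * c = 1) (z : ideleGroup E) :
    conjIdele F E c (conjIdele F E c z) = z :=
  Units.ext (conjAdele_conjAdele' hc _)

variable {F E c} in
omit [NumberField F] in
/-- The scalar `1 × 1` matrix of `z · c(z)⁻¹` lies in `U(1)_{E/F}(𝔸_F) = U(J₁)(𝔸_F)`:
`c(z c(z)⁻¹) · (z c(z)⁻¹) = 1`. [folklore] -/
theorem scalar_mul_conjIdele_inv_mem (hc : c * c = 1) (z : ideleGroup E) :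
    Matrix.GeneralLinearGroup.scalar (Fin 1) (z * (conjIdele F E c z)⁻¹) ∈
      adelic F E c 1 ((StdForm.antidiagonal 1).over E) := by
  change Units.map (Matrix.scalar (Fin 1) : AdeleRing (𝓞 E) E →+* _).toMonoidHom
      (z * (conjIdele F E c z)⁻¹) ∈ unitaryGroupOfForm (conjAdele F E c) _
  refine scalar_mem_unitaryGroupOfForm _ _ _ ?_
  have h1 : (conjAdele F E c) ((z * (conjIdele F E c z)⁻¹ : ideleGroup E) : AdeleRing (𝓞 E) E) =
      ((conjIdele F E c z * z⁻¹ : ideleGroup E) : AdeleRing (𝓞 E) E) := by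
    change ((conjIdele F E c (z * (conjIdele F E c z)⁻¹) : ideleGroup E) : AdeleRing (𝓞 E) E) = _
    rw [map_mul, map_inv, conjIdele_conjIdele hc]
  rw [h1, ← Units.val_mul]
  have h2 : conjIdele F E c z * z⁻¹ * (z * (conjIdele F E c z)⁻¹) = 1 := by group
  rw [h2, Units.val_one]

variable {F E c} in
omit [NumberField F] in
/-- `z w (c(z w))⁻¹ = (z c(z)⁻¹) (w c(w)⁻¹)` in the (commutative) idèle group. [folklore] -/
theorem mul_conjIdele_inv_mul (z w : ideleGroup E) :
    z * w * (conjIdele F E c (z * w))⁻¹ = (z * (conjIdele F E c z)⁻¹) * (w * (conjIdele F E c w)⁻¹) := by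
  rw [map_mul, mul_inv, mul_mul_mul_comm]

/-- **The homomorphism `z ↦ z^{1-c} = z · c(z)⁻¹` from the idèles of `E` to the adelic points of the
norm-one torus `U(1)_{E/F} = U(J₁)`** (Mok's `U_{E/F}(1)`, the centre of `U_{E/F}(N)`; the
surjectivity of this map is Hilbert's Theorem 90, not used here). Requires `c² = 1`.
Mok 2014, §1 Notation (p. 5): `U_{E/F}(1) = {z | c(z) z = 1}`. [cite: Mok2014, §1 Notation p. 5] -/
def toNormOne (hc : c * c = 1) : ideleGroup E →* (quasiSplit F E c 1).Adelic where
  toFun z := ⟨Matrix.GeneralLinearGroup.scalar (Fin 1) (z * (conjIdele F E c z)⁻¹),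
    scalar_mul_conjIdele_inv_mem hc z⟩
  map_one' := by
    apply Subtype.ext
    change Matrix.GeneralLinearGroup.scalar (Fin 1) (1 * (conjIdele F E c 1)⁻¹) = 1
    rw [map_one, inv_one, mul_one, map_one]
  map_mul' z w := by
    apply Subtype.ext
    change Matrix.GeneralLinearGroup.scalar (Fin 1) (z * w * (conjIdele F E c (z * w))⁻¹) =
      Matrix.GeneralLinearGroup.scalar (Fin 1) (z * (conjIdele F E c z)⁻¹) *
        Matrix.GeneralLinearGroup.scalar (Fin 1) (w * (conjIdele F E c w)⁻¹)
    rw [mul_conjIdele_inv_mul, map_mul]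

variable {F E c}
variable {hc : c * c = 1}

/-- `toNormOne z` as an element of `GL₁(𝔸_E)` is the scalar matrix of `z · c(z)⁻¹` (definitional).
[folklore] -/
theorem adelicVal_toNormOne (z : ideleGroup E) :
    adelicVal F E c 1 _ (toNormOne F E c hc z) =
      Matrix.GeneralLinearGroup.scalar (Fin 1) (z * (conjIdele F E c z)⁻¹) := rfl

/-- The entries of `toNormOne z` are the adèle `z · c(z)⁻¹`. [folklore] -/
theorem adelicVal_toNormOne_val_apply (z : ideleGroup E) (i j : Fin 1) :
    (adelicVal F E c 1 _ (toNormOne F E c hc z)).val i j =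
      ((z * (conjIdele F E c z)⁻¹ : ideleGroup E) : AdeleRing (𝓞 E) E) := by
  rw [adelicVal_toNormOne, GeneralLinearGroup.scalar_fin_one_val_apply]

variable (F c) in
omit [NumberField F] in
/-- **`c ⊗ 1` on a local idèle**: `c • (x at v, 1 elsewhere) = (c_v x at c • v, 1 elsewhere)`
(`FiniteAdeleRing.smul_mulSingle`). [folklore] -/
theorem conjIdele_localUnits (v : HeightOneSpectrum (𝓞 E)) (x : (v.adicCompletion E)ˣ) :
    conjIdele F E c (localUnits v x) = localUnits (c • v) (galAdicCompletionUnitsEquiv c rfl x) := by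
  refine Units.ext (Prod.ext ?_ ?_)
  · rw [coe_conjIdele, AdeleRing.smul_fst, localUnits_fst, localUnits_fst]
    exact smul_one c
  · rw [coe_conjIdele, AdeleRing.smul_snd]
    change c • finiteAdeleSingle v (x : v.adicCompletion E) =
      finiteAdeleSingle (c • v) (galAdicCompletionMap c rfl (x : v.adicCompletion E))
    exact FiniteAdeleRing.smul_mulSingle E c v (x : v.adicCompletion E)

/-- Components of the inverse of an idèle: `(z⁻¹)_w = (z_w)⁻¹` in the field `E_w`. [folklore] -/
theorem adeleEval_units_inv (z : ideleGroup E) (w : HeightOneSpectrum (𝓞 E)) :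
    AdelicGroupData.adeleEval E w ((z⁻¹ : ideleGroup E) : AdeleRing (𝓞 E) E) =
      (AdelicGroupData.adeleEval E w (z : AdeleRing (𝓞 E) E))⁻¹ :=
  map_units_inv (AdelicGroupData.adeleEval E w) z

/-- Components of a local idèle away from its place are `1`. [folklore] -/
theorem adeleEval_localUnits_of_ne {v w : HeightOneSpectrum (𝓞 E)} (x : (v.adicCompletion E)ˣ) (h : w ≠ v) :
    AdelicGroupData.adeleEval E w ((localUnits v x : ideleGroup E) : AdeleRing (𝓞 E) E) = 1 := by
  rw [AdelicGroupData.adeleEval_apply]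
  exact finiteAdeleSingle_apply_of_ne (x : v.adicCompletion E) h

/-- The component of a local idèle at its place. [folklore] -/
theorem adeleEval_localUnits_self (v : HeightOneSpectrum (𝓞 E)) (x : (v.adicCompletion E)ˣ) :
    AdelicGroupData.adeleEval E v ((localUnits v x : ideleGroup E) : AdeleRing (𝓞 E) E) = x := by
  rw [AdelicGroupData.adeleEval_apply]
  exact finiteAdeleSingle_apply_self v (x : v.adicCompletion E)

/-- **The `v`-component of the entry of `toNormOne (x at v)` is `x`** when `c • v ≠ v` (the conjugate
factor lives at `c • v`). [folklore] -/
theorem adeleEval_adelicVal_toNormOne_localUnits_self {v : HeightOneSpectrum (𝓞 E)} (hv : c • v ≠ v)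
    (x : (v.adicCompletion E)ˣ) (i j : Fin 1) :
    AdelicGroupData.adeleEval E v ((adelicVal F E c 1 _ (toNormOne F E c hc (localUnits v x))).val i j) = x := by
  rw [adelicVal_toNormOne_val_apply, Units.val_mul, map_mul, adeleEval_localUnits_self,
    adeleEval_units_inv, conjIdele_localUnits F c, adeleEval_localUnits_of_ne _ (Ne.symm hv),
    inv_one, mul_one]

/-- The diagonal order at `v` of `toNormOne (x at v)` is `ord_v(x)` when `c • v ≠ v`. [folklore] -/
theorem diagOrd_toNormOne_localUnits {v : HeightOneSpectrum (𝓞 E)} (hv : c • v ≠ v)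
    (x : (v.adicCompletion E)ˣ) (i : Fin 1) :
    diagOrd F E c 1 v (toNormOne F E c hc (localUnits v x)) i =
      -WithZero.log (Valued.v (x : v.adicCompletion E)) := by
  rw [diagOrd]
  change -WithZero.log (Valued.v (AdelicGroupData.adeleEval E v
    ((adelicVal F E c 1 _ (toNormOne F E c hc (localUnits v x))).val i i))) = _
  rw [adeleEval_adelicVal_toNormOne_localUnits_self hv]

/-- The component homomorphism `GL₁(𝔸_E) → GL₁(E_w)` kills `toNormOne (x at v)` for `w ∉ {v, c • v}`.
[folklore] -/
theorem map_adeleEval_adelicVal_toNormOne_localUnits_of_ne {v w : HeightOneSpectrum (𝓞 E)}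
    (hw : w ≠ v) (hwc : w ≠ c • v) (x : (v.adicCompletion E)ˣ) :
    Matrix.GeneralLinearGroup.map (AdelicGroupData.adeleEval E w)
      (adelicVal F E c 1 _ (toNormOne F E c hc (localUnits v x))) = 1 := by
  refine Matrix.GeneralLinearGroup.ext fun i j => ?_
  rw [Subsingleton.elim i 0, Subsingleton.elim j 0]
  change AdelicGroupData.adeleEval E w ((adelicVal F E c 1 _ (toNormOne F E c hc (localUnits v x))).val 0 0) =
    (1 : Matrix (Fin 1) (Fin 1) (w.adicCompletion E)) 0 0
  rw [Matrix.one_apply_eq, adelicVal_toNormOne_val_apply, Units.val_mul, map_mul,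
    adeleEval_localUnits_of_ne _ hw, adeleEval_units_inv, conjIdele_localUnits F c,
    adeleEval_localUnits_of_ne _ hwc, inv_one, mul_one]

omit [NumberField F] in
/-- The archimedean part of a local idèle is `1`, as a unit. [folklore] -/
theorem unitsMap_adeleFst_localUnits (v : HeightOneSpectrum (𝓞 E)) (x : (v.adicCompletion E)ˣ) :
    Units.map (adeleFst E).toMonoidHom (localUnits v x) = 1 :=
  Units.ext (localUnits_fst v x)

/-- The archimedean part of `toNormOne (x at v)` is `1`. [folklore] -/
theorem fstHom_adelicVal_toNormOne_localUnits (v : HeightOneSpectrum (𝓞 E)) (x : (v.adicCompletion E)ˣ) :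
    GLn.fstHom 1 E (adelicVal F E c 1 _ (toNormOne F E c hc (localUnits v x))) = 1 := by
  refine Matrix.GeneralLinearGroup.ext fun i j => ?_
  rw [Subsingleton.elim i 0, Subsingleton.elim j 0]
  change RingHom.fst (InfiniteAdeleRing E) (FiniteAdeleRing (𝓞 E) E)
      ((adelicVal F E c 1 _ (toNormOne F E c hc (localUnits v x))).val 0 0) =
    (1 : Matrix (Fin 1) (Fin 1) (InfiniteAdeleRing E)) 0 0
  rw [Matrix.one_apply_eq, adelicVal_toNormOne_val_apply]
  change ((Units.map (adeleFst E).toMonoidHom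
    (localUnits v x * (conjIdele F E c (localUnits v x))⁻¹) : (InfiniteAdeleRing E)ˣ) : InfiniteAdeleRing E) = 1
  rw [map_mul, map_inv, unitsMap_adeleFst_localUnits, conjIdele_localUnits F c, unitsMap_adeleFst_localUnits,
    inv_one, mul_one, Units.val_one]

/-- **`toNormOne (x at v)` is supported over the place of `F` below `v`.** [folklore] -/
theorem isSupportedAt_toNormOne_localUnits (v : HeightOneSpectrum (𝓞 E)) (x : (v.adicCompletion E)ˣ) :
    IsSupportedAt F E c 1 v (toNormOne F E c hc (localUnits v x)) :=
  ⟨fstHom_adelicVal_toNormOne_localUnits v x,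
    fun _ hw hwc => map_adeleEval_adelicVal_toNormOne_localUnits_of_ne hw hwc x⟩

/-- **`toNormOne (u at v) ∈ K_U(𝔫)` for a local unit `u ∈ 𝒪_vˣ` and `v, c • v ∤ 𝔫`**: the scalar
idèle `u` lies in the principal congruence subgroup `K(𝔫)` (`scalar_localUnits_mem_of_isMaximalAt`),
and so does its conjugate, the scalar of the local unit `c_v u` at `c • v`. [folklore] -/
theorem toNormOne_localUnits_mem_level {𝔫 : Ideal (𝓞 E)} (h𝔫 : 𝔫 ≠ 0) {v : HeightOneSpectrum (𝓞 E)}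
    (hv : ¬ v.asIdeal ∣ 𝔫) (hcv : ¬ (c • v).asIdeal ∣ 𝔫) (u : (v.adicCompletionIntegers E)ˣ) :
    toNormOne F E c hc (localUnits v (Units.map ((v.adicCompletionIntegers E).subtype : _ →* _) u)) ∈
      level F E c 1 𝔫 := by
  rw [level, Subgroup.mem_comap, adelicVal_toNormOne, map_mul, map_inv]
  refine Subgroup.mul_mem _ ?_ (Subgroup.inv_mem _ ?_)
  · exact scalar_localUnits_mem_of_isMaximalAt (isMaximalAt_principalCongruenceLevel 1 E v h𝔫 hv) u
  · rw [conjIdele_localUnits F c, scalar_localUnits_eq_ofLocal]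
    refine isMaximalAt_principalCongruenceLevel 1 E (c • v) h𝔫 hcv ⟨_, ?_, rfl⟩
    have hu1 : Valued.v ((Units.map ((v.adicCompletionIntegers E).subtype : _ →* _) u :
        (v.adicCompletion E)ˣ) : v.adicCompletion E) ≤ 1 :=
      (HeightOneSpectrum.mem_adicCompletionIntegers (R := 𝓞 E) E v).mp (u : v.adicCompletionIntegers E).2
    have hu2 : Valued.v (((Units.map ((v.adicCompletionIntegers E).subtype : _ →* _) u)⁻¹ :
        (v.adicCompletion E)ˣ) : v.adicCompletion E) ≤ 1 := by
      rw [← map_inv]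
      exact (HeightOneSpectrum.mem_adicCompletionIntegers (R := 𝓞 E) E v).mp
        ((u⁻¹ : (v.adicCompletionIntegers E)ˣ) : v.adicCompletionIntegers E).2
    refine scalar_mem_valuedCongruenceSubgroup_one (c • v) ?_ ?_
    · rw [valued_galAdicCompletionUnitsEquiv]; exact hu1
    · rw [← map_inv, valued_galAdicCompletionUnitsEquiv]; exact hu2

end UnitaryGroup

/-- Entries of products of `1 × 1` invertible matrices multiply. [folklore] -/
theorem GeneralLinearGroup.val_mul_apply_fin_one {R : Type*} [CommRing R] (g h : GL (Fin 1) R) (i j : Fin 1) :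
    (g * h).val i j = g.val i j * h.val i j := by
  rw [Subsingleton.elim i 0, Subsingleton.elim j 0, Units.val_mul, Matrix.mul_apply]
  simp

namespace UnitaryGroup

variable {F E : Type} [Field F] [NumberField F] [Field E] [NumberField E] [Algebra F E]
  {c : E ≃ₐ[F] E}

/-- **In rank one the Hecke operator `[K t K]` on a `K`-fixed function is the translation `r(t)`**
(`U(1)(𝔸_F)` is commutative, so `K t K = t K` is a single coset). Cartier 1979, §IV (4.2).
[folklore] -/
theorem heckeOperator_rightTranslation_rank_one (K : Subgroup (quasiSplit F E c 1).Adelic)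
    (t : (quasiSplit F E c 1).Adelic) {φ : (quasiSplit F E c 1).Adelic → ℂ}
    (hφ : IsRightInvariantUnder K φ) :
    heckeOperator (rightTranslation (quasiSplit F E c 1)) K t φ =
      rightTranslation (quasiSplit F E c 1) t φ := by
  have horb : MulAction.orbit K (t : (quasiSplit F E c 1).Adelic ⧸ K) = {(t : _ ⧸ K)} := by
    ext y
    simp only [Set.mem_singleton_iff, MulAction.mem_orbit_iff]
    constructor
    · rintro ⟨k, rfl⟩
      change (((k : (quasiSplit F E c 1).Adelic) * t : (quasiSplit F E c 1).Adelic) : _ ⧸ K) = (t : _ ⧸ K)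
      rw [mul_comm_rank_one F E c (k : (quasiSplit F E c 1).Adelic) t, QuotientGroup.mk_mul_of_mem t k.2]
    · rintro rfl
      exact MulAction.mem_orbit_self _
  have hbij : Set.BijOn (fun x : (quasiSplit F E c 1).Adelic => (x : _ ⧸ K))
      ({t} : Finset (quasiSplit F E c 1).Adelic) (MulAction.orbit K (t : _ ⧸ K)) := by
    rw [Finset.coe_singleton, horb]
    exact Set.bijOn_singleton.mpr rfl
  rw [heckeOperator_apply_eq_sum _ K t {t} hbij
    ((isRightInvariantUnder_iff_mem_fixedPoints (quasiSplit F E c 1) K φ).1 hφ), Finset.sum_singleton]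

omit [NumberField F] [NumberField E] in
/-- At any place all (`= 1`) torus coordinates of `U(1)` are free. [folklore] -/
theorem torusIndices_rank_one (w : HeightOneSpectrum (𝓞 E)) : torusIndices F E c 1 w = Finset.univ := by
  ext i
  simp [torusIndices]

/-- **The Iwasawa character in rank one**: `(χ_β δ_B^{1/2})(b) = β₀ ^ {ord_w(b)}` (the modulus factor
`(√q_w)^{-(N-1-2i) ord}` is trivial for `N = 1`, `i = 0`). Cartier 1979, §3.3. [folklore] -/
theorem iwasawaChar_rank_one (w : HeightOneSpectrum (𝓞 E)) (β : Fin 1 → ℂ) (b : (quasiSplit F E c 1).Adelic) :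
    iwasawaChar F E c 1 w β b = β 0 ^ diagOrd F E c 1 w b 0 := by
  unfold iwasawaChar
  rw [torusIndices_rank_one, Fin.prod_univ_one]
  have h0 : -((((1 : ℕ) : ℤ) - 1 - 2 * ((0 : Fin 1) : ℕ)) * diagOrd F E c 1 w b 0) = 0 := by simp
  rw [h0, zpow_zero, mul_one]

/-- Upper-triangularity at a place is vacuous in rank one. [folklore] -/
theorem isUpperTriangularAt_rank_one (w : HeightOneSpectrum (𝓞 E)) (b : (quasiSplit F E c 1).Adelic) :
    IsUpperTriangularAt F E c 1 w b :=
  fun i j hij => absurd hij (by rw [Subsingleton.elim i j]; exact lt_irrefl _)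

/-- The `w`-component of the entry of an element of a level `K_U(𝔫)` is a `w`-adic unit. [folklore] -/
theorem valued_adeleEval_val_eq_one_of_mem_level {𝔫 : Ideal (𝓞 E)} {k : (quasiSplit F E c 1).Adelic}
    (hk : k ∈ level F E c 1 𝔫) (w : HeightOneSpectrum (𝓞 E)) (i j : Fin 1) :
    Valued.v (AdelicGroupData.adeleEval E w ((adelicVal F E c 1 _ k).val i j)) = 1 := by
  rw [level, Subgroup.mem_comap, mem_principalCongruenceLevel_iff, mem_glIntegralLevel_iff'] at hk
  obtain ⟨⟨⟨h₁, h₂⟩, -⟩, -⟩ := hk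
  set g := adelicVal F E c 1 _ k with hg
  have ha : Valued.v (AdelicGroupData.adeleEval E w (g.val i j)) ≤ 1 :=
    (HeightOneSpectrum.mem_adicCompletionIntegers (R := 𝓞 E) E w).mp (h₁ i j w)
  have hb : Valued.v (AdelicGroupData.adeleEval E w ((g⁻¹).val i j)) ≤ 1 :=
    (HeightOneSpectrum.mem_adicCompletionIntegers (R := 𝓞 E) E w).mp (h₂ i j w)
  have hprod : AdelicGroupData.adeleEval E w (g.val i j) * AdelicGroupData.adeleEval E w ((g⁻¹).val i j) = 1 := by
    rw [← map_mul, ← GeneralLinearGroup.val_mul_apply_fin_one, mul_inv_cancel, Subsingleton.elim j i]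
    change AdelicGroupData.adeleEval E w ((1 : Matrix (Fin 1) (Fin 1) (AdeleRing (𝓞 E) E)) i i) = 1
    rw [Matrix.one_apply_eq, map_one]
  have hva : Valued.v (AdelicGroupData.adeleEval E w (g.val i j)) ≠ 0 := by
    intro h0
    have := congrArg Valued.v hprod
    rw [map_mul, map_one, h0, zero_mul] at this
    exact zero_ne_one this
  have hinv : Valued.v (AdelicGroupData.adeleEval E w ((g⁻¹).val i j)) =
      (Valued.v (AdelicGroupData.adeleEval E w (g.val i j)))⁻¹ := by
    rw [eq_inv_of_mul_eq_one_right hprod, map_inv₀]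
  rw [hinv, inv_le_one₀ (lt_of_le_of_ne zero_le hva.symm)] at hb
  exact le_antisymm ha hb

/-- Diagonal orders are insensitive to right multiplication by a level element. [folklore] -/
theorem diagOrd_mul_of_mem_level {𝔫 : Ideal (𝓞 E)} {k : (quasiSplit F E c 1).Adelic}
    (hk : k ∈ level F E c 1 𝔫) (t : (quasiSplit F E c 1).Adelic) (w : HeightOneSpectrum (𝓞 E)) (i : Fin 1) :
    diagOrd F E c 1 w (t * k) i = diagOrd F E c 1 w t i := by
  unfold diagOrd
  change -WithZero.log (Valued.v (AdelicGroupData.adeleEval E w ((adelicVal F E c 1 _ (t * k)).val i i))) =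
    -WithZero.log (Valued.v (AdelicGroupData.adeleEval E w ((adelicVal F E c 1 _ t).val i i)))
  rw [map_mul, GeneralLinearGroup.val_mul_apply_fin_one, map_mul, map_mul,
    valued_adeleEval_val_eq_one_of_mem_level hk, mul_one]

/-- **The unramified Hecke eigenvalue in rank one**: for `t` supported over the place below `w`,
`λ_β([K_U(𝔫) t K_U(𝔫)]) = β₀ ^ {ord_w(t)}` (one coset, whose admissible representatives differ from
`t` by elements of `K_U(𝔫)`, which have unit `w`-components). Cartier 1979, §IV (4.2). [folklore] -/
theorem heckeEigenvalue_rank_one (𝔫 : Ideal (𝓞 E)) (w : HeightOneSpectrum (𝓞 E)) (β : Fin 1 → ℂ)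
    {t : (quasiSplit F E c 1).Adelic} (ht : IsSupportedAt F E c 1 w t) :
    heckeEigenvalue F E c 1 w β (level F E c 1 𝔫) t = β 0 ^ diagOrd F E c 1 w t 0 := by
  unfold heckeEigenvalue
  have horb : MulAction.orbit (level F E c 1 𝔫) (t : (quasiSplit F E c 1).Adelic ⧸ level F E c 1 𝔫) =
      {(t : _ ⧸ level F E c 1 𝔫)} := by
    ext y
    simp only [Set.mem_singleton_iff, MulAction.mem_orbit_iff]
    constructor
    · rintro ⟨k, rfl⟩
      change (((k : (quasiSplit F E c 1).Adelic) * t : (quasiSplit F E c 1).Adelic) : _ ⧸ level F E c 1 𝔫) = _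
      rw [mul_comm_rank_one F E c (k : (quasiSplit F E c 1).Adelic) t, QuotientGroup.mk_mul_of_mem t k.2]
    · rintro rfl
      exact MulAction.mem_orbit_self _
  rw [horb, finsum_mem_singleton]
  unfold iwasawaValue
  have h : ∃ b : (quasiSplit F E c 1).Adelic, IsSupportedAt F E c 1 w b ∧ IsUpperTriangularAt F E c 1 w b ∧
      (b : (quasiSplit F E c 1).Adelic ⧸ level F E c 1 𝔫) = (t : _ ⧸ level F E c 1 𝔫) :=
    ⟨t, ht, isUpperTriangularAt_rank_one w t, rfl⟩
  rw [dif_pos h, iwasawaChar_rank_one]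
  have hq := h.choose_spec.2.2
  have hk : t⁻¹ * h.choose ∈ level F E c 1 𝔫 := QuotientGroup.eq.mp hq.symm
  have heq : h.choose = t * (t⁻¹ * h.choose) := by group
  rw [heq, diagOrd_mul_of_mem_level hk]

variable {hcpt : isCompact_glFiniteIntegralLevel 1 E}

/-- **Base-change Satake parameters in rank one, read as eigenvalues of translations.** If `π` (an
automorphic representation datum of `U(1)_{E/F}`) has base-change Satake parameter `α` at `w`, then
`α = {b}` with `b ≠ 0`, `b = 1` if `c • w = w`, and there are a level `𝔫 ≠ 0` prime to `w` and `c • w`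
and a form `φ ∈ W ∖ W'` fixed by `K_U(𝔫)` such that `r(t) φ - b^{ord_w(t)} φ ∈ W'` for every `t`
supported over the place below `w` (`heckeOperator_rightTranslation_rank_one`,
`heckeEigenvalue_rank_one`). Mok 2014, §2.1–2.2 (`N = 1`); Mínguez 2011, Thm. 4.1. [folklore] -/
theorem HasBaseChangeSatakeAt.rank_one {π : AutomorphicRepData (quasiSplitDatum F E c 1 hcpt)}
    {w : HeightOneSpectrum (𝓞 E)} {α : Multiset ℂ} (h : HasBaseChangeSatakeAt F E c 1 hcpt π w α) :
    ∃ (b : ℂ) (𝔫 : Ideal (𝓞 E)), α = {b} ∧ b ≠ 0 ∧ (c • w = w → b = 1) ∧ 𝔫 ≠ 0 ∧ ¬ w.asIdeal ∣ 𝔫 ∧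
      ¬ (c • w).asIdeal ∣ 𝔫 ∧ ∃ φ ∈ π.W, φ ∉ π.W' ∧
        (∀ u ∈ level F E c 1 𝔫, rightTranslation (quasiSplit F E c 1) u φ = φ) ∧
        ∀ t : (quasiSplit F E c 1).Adelic, IsSupportedAt F E c 1 w t →
          rightTranslation (quasiSplit F E c 1) t φ - (b ^ diagOrd F E c 1 w t 0) • φ ∈ π.W' := by
  obtain ⟨𝔫, β, h𝔫, hw𝔫, hcw𝔫, hβ, rfl, φ, hφW, hφW', hfix, heig⟩ := h
  refine ⟨β 0, 𝔫, ?_, hβ.1 0, fun hw => ?_, h𝔫, hw𝔫, hcw𝔫, φ, hφW, hφW', hfix, fun t ht => ?_⟩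
  · rw [Finset.univ_unique, Finset.singleton_val, Multiset.map_singleton]
    rfl
  · have := (hβ.2 hw 0).2 (Subsingleton.elim _ _)
    exact this
  · have hinv : IsRightInvariantUnder (level F E c 1 𝔫) φ := fun u hu g => by
      have := congrFun (hfix u hu) g
      rwa [rightTranslation_apply] at this
    have := heig t ht
    rwa [heckeOperator_rightTranslation_rank_one _ t hinv, heckeEigenvalue_rank_one 𝔫 w β ht] at this

end UnitaryGroup

/-! ### Eigenvectors modulo a subspace inside a finite-dimensional stable subspace -/

section Eigen

variable {M : Type*} [AddCommGroup M] [Module ℂ M]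

/-- **An eigenvector modulo `W'` inside a finite-dimensional `T`-stable subspace.** Let `V` be a
finite-dimensional complex subspace of functions preserved by an operator `T` which is additive and
homogeneous on `V` and maps `V ∩ W'` into `W'`. If `V ⊄ W'`, some `v ∈ V ∖ W'` is an eigenvector of
`T` modulo `W'`: the induced endomorphism of the non-zero finite-dimensional quotient
`V / (V ∩ W')` has an eigenvector (`Module.End.exists_eigenvalue`). [folklore] -/
theorem exists_sub_smul_mem_of_finiteDimensional (V W' : Submodule ℂ M) [FiniteDimensional ℂ V]
    (T : M → M) (hTV : ∀ v ∈ V, T v ∈ V) (hadd : ∀ v ∈ V, ∀ w ∈ V, T (v + w) = T v + T w)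
    (hsmul : ∀ (a : ℂ), ∀ v ∈ V, T (a • v) = a • T v) (hTW' : ∀ v ∈ V, v ∈ W' → T v ∈ W')
    (h0 : ∃ φ₀ ∈ V, φ₀ ∉ W') :
    ∃ (d : ℂ), ∃ v ∈ V, v ∉ W' ∧ T v - d • v ∈ W' := by
  let TV : V →ₗ[ℂ] V :=
    { toFun := fun v => ⟨T v, hTV v v.2⟩
      map_add' := fun v w => Subtype.ext (hadd v v.2 w w.2)
      map_smul' := fun a v => Subtype.ext (hsmul a v v.2) }
  let P : Submodule ℂ V := W'.comap V.subtype
  have hP : P ≤ P.comap TV := fun v hv => hTW' v v.2 hv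
  let TQ : Module.End ℂ (V ⧸ P) := P.mapQ P TV hP
  have hmk0 : ∀ v : V, P.mkQ v = 0 ↔ (v : M) ∈ W' := by
    intro v
    rw [Submodule.mkQ_apply, Submodule.Quotient.mk_eq_zero]
    rfl
  haveI : Nontrivial (V ⧸ P) := by
    obtain ⟨φ₀, hφ₀V, hφ₀W'⟩ := h0
    refine ⟨⟨P.mkQ ⟨φ₀, hφ₀V⟩, 0, fun h => hφ₀W' ((hmk0 ⟨φ₀, hφ₀V⟩).1 h)⟩⟩
  obtain ⟨d, hd⟩ := Module.End.exists_eigenvalue TQ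
  obtain ⟨q, hq, hq0⟩ := hd.exists_hasEigenvector
  induction q using Submodule.Quotient.induction_on with
  | H v =>
    refine ⟨d, v, v.2, fun hv => hq0 ((hmk0 v).2 hv), ?_⟩
    rw [Module.End.mem_eigenspace_iff] at hq
    have h1 : P.mkQ (TV v - d • v) = 0 := by
      rw [map_sub, map_smul]
      exact sub_eq_zero.2 hq
    exact (hmk0 _).1 h1

end Eigen

/-! ### The archimedean torus `U(1)_{E/F}(E ⊗ ℝ)`: commutativity -/

namespace UnitaryGroup

variable {F E : Type} [Field F] [NumberField F] [Field E] [NumberField E] [Algebra F E]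
  {c : E ≃ₐ[F] E} {hcpt : isCompact_glFiniteIntegralLevel 1 E}

/-- **`𝔲(1)^d` is abelian**: all brackets in `𝔤 = Lie U(J₁)(E ⊗ ℝ) ≤ 𝔤𝔩₁(E ⊗ ℝ)` vanish. [folklore] -/
theorem lie_eq_zero_rank_one (X Y : (quasiSplitDatum F E c 1 hcpt).arch.lie) : ⁅X, Y⁆ = 0 := by
  apply Subtype.ext
  rw [LieSubalgebra.coe_bracket, ZeroMemClass.coe_zero, LieRing.of_associative_ring_bracket]
  have hcomm : (X : Matrix (Fin 1) (Fin 1) (mixedSpace E)) * (Y : Matrix (Fin 1) (Fin 1) (mixedSpace E)) =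
      (Y : Matrix (Fin 1) (Fin 1) (mixedSpace E)) * (X : Matrix (Fin 1) (Fin 1) (mixedSpace E)) := by
    refine Matrix.ext fun i j => ?_
    rw [Subsingleton.elim i 0, Subsingleton.elim j 0]
    simp [Matrix.mul_apply, mul_comm]
  rw [hcomm, sub_self]

/-- Right translations on `U(1)(𝔸_F)` commute. [folklore] -/
theorem rightTranslation_comm_rank_one (a b : (quasiSplit F E c 1).Adelic) (φ : (quasiSplit F E c 1).Adelic → ℂ) :
    rightTranslation (quasiSplit F E c 1) a (rightTranslation (quasiSplit F E c 1) b φ) =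
      rightTranslation (quasiSplit F E c 1) b (rightTranslation (quasiSplit F E c 1) a φ) := by
  rw [← Module.End.mul_apply, ← map_mul, mul_comm_rank_one F E c a b, map_mul, Module.End.mul_apply]

/-- On `U(1)(𝔸_F)` the Lie derivatives commute with every right translation. [folklore] -/
theorem lieDeriv_rightTranslation_rank_one (X : (quasiSplitDatum F E c 1 hcpt).arch.lie)
    (h : (quasiSplit F E c 1).Adelic) (φ : (quasiSplit F E c 1).Adelic → ℂ) :
    lieDeriv (quasiSplitDatum F E c 1 hcpt).ofArch X (rightTranslation (quasiSplit F E c 1) h φ) =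
      rightTranslation (quasiSplit F E c 1) h (lieDeriv (quasiSplitDatum F E c 1 hcpt).ofArch X φ) :=
  lieDeriv_rightTranslation_of_forall_commute X (fun _ => mul_comm_rank_one F E c _ _) φ

/-! ### Automorphic forms on `U(J₀)`: the levels are directed -/

variable (F E c hcpt) in
/-- The levels of the automorphy datum of `U(J₀)` (traces of compact open subgroups of
`GL_N(𝔸_E^∞)`) are directed: two compact open subgroups contain the compact open subgroup
`U₁ ∩ U₂` (open subgroups are closed). Borel–Jacquet 1979, §4.1. [folklore] -/
theorem directedOn_finiteLevels {N : ℕ} (S : StdForm N) (hcpt' : isCompact_glFiniteIntegralLevel N E) :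
    DirectedOn (· ≥ ·) (automorphyDatum F E c N S hcpt').finiteLevels := by
  rintro L₁ ⟨U₁, hU₁o, hU₁c, rfl⟩ L₂ ⟨U₂, hU₂o, hU₂c, rfl⟩
  refine ⟨((U₁ ⊓ U₂).map (GLn.ofFinite N E)).comap (adelic F E c N (S.over E)).subtype,
    ⟨U₁ ⊓ U₂, hU₁o.inter hU₂o, ?_, rfl⟩, ?_, ?_⟩
  · exact hU₁c.inter_right (U₂.isClosed_of_isOpen hU₂o)
  · exact Subgroup.comap_mono (Subgroup.map_mono inf_le_left)
  · exact Subgroup.comap_mono (Subgroup.map_mono inf_le_right)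

/-- Members of a stable subspace for the `U(J₀)` datum are automorphic forms
(`mem_automorphicForms_iff_holds` with `directedOn_finiteLevels`). Borel–Jacquet 1979, 4.3. [folklore] -/
theorem isAutomorphicForm_of_mem {N : ℕ} {S : StdForm N} {hcpt' : isCompact_glFiniteIntegralLevel N E}
    {W : Submodule ℂ ((adelicGroupData F E c N (S.over E)).Adelic → ℂ)}
    (hW : IsStableSubmodule (automorphyDatum F E c N S hcpt') W) {φ : (adelicGroupData F E c N (S.over E)).Adelic → ℂ}
    (hφ : φ ∈ W) : IsAutomorphicForm (automorphyDatum F E c N S hcpt') φ :=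
  (mem_automorphicForms_iff_holds (𝒟 := automorphyDatum F E c N S hcpt') (directedOn_finiteLevels F E c S hcpt') φ).1
    (hW.le_automorphicForms hφ)

/-! ### Stability under the one-parameter subgroups and the three families of scalars -/

/-- **Stable spaces of automorphic forms on `U(1)` are stable under the one-parameter subgroups of
`U(1)_∞`**: `r(exp tX) φ ∈ W` (`𝔤` abelian ⇒ `X` preserves the finite-dimensional `Z(𝔤)`-orbit span
of `φ`; `archTranslate_expMem_mem_of_lieDeriv_mem`). Borel–Jacquet 1979, 4.6; Borel 1997, 8.6. [folklore] -/
theorem _root_.Literature.NumberTheory.Automorphic.IsStableSubmodule.rightTranslation_ofArch_expMem_mem_rank_one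
    {W : Submodule ℂ ((quasiSplit F E c 1).Adelic → ℂ)}
    (hW : IsStableSubmodule (quasiSplitDatum F E c 1 hcpt) W) (X : (quasiSplitDatum F E c 1 hcpt).arch.lie)
    (t : ℝ) {φ : (quasiSplit F E c 1).Adelic → ℂ} (hφ : φ ∈ W) :
    rightTranslation (quasiSplit F E c 1)
      ((quasiSplitDatum F E c 1 hcpt).ofArch ((quasiSplitDatum F E c 1 hcpt).arch.expMem (t • X))) φ ∈ W := by
  have hφform : IsAutomorphicForm (quasiSplitDatum F E c 1 hcpt) φ := isAutomorphicForm_of_mem hW hφ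
  have hφs : IsArchSmooth (quasiSplitDatum F E c 1 hcpt).ofArch φ := hφform.archSmooth
  set V := zOrbitSpan (quasiSplitDatum F E c 1 hcpt).ofArch φ with hV
  haveI : FiniteDimensional ℂ V := hφform.zFinite
  have hVW : V ≤ W := Submodule.span_le.2 (by
    rintro _ ⟨p, -, rfl⟩
    exact hW.applyFree_mem p hφ)
  have hVs : ∀ ψ ∈ V, IsArchSmooth (quasiSplitDatum F E c 1 hcpt).ofArch ψ :=
    fun ψ hψ => isArchSmooth_of_mem_zOrbitSpan _ hφs hψ
  have hVX : ∀ ψ ∈ V, lieDeriv (quasiSplitDatum F E c 1 hcpt).ofArch X ψ ∈ V :=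
    fun ψ hψ => lieDeriv_mem_zOrbitSpan_of_forall_lie_eq_zero _ (lie_eq_zero_rank_one X) hφs hψ
  exact hVW (archTranslate_expMem_mem_of_lieDeriv_mem _ V hVs X hVX (mem_zOrbitSpan_self _ φ) t)

/-- **Every `X ∈ 𝔲(1)^d` acts by a scalar on an automorphic representation `W / W'` of `U(1)`**
(an eigenvector of `X` modulo `W'` exists in the finite-dimensional `X`-stable `Z(𝔤)`-orbit span of a
form `φ₀ ∈ W ∖ W'`, and is promoted to all of `W / W'` by irreducibility,
`forall_sub_smul_mem_of_exists'`). Borel–Jacquet 1979, 4.6. [folklore] -/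
theorem _root_.Literature.NumberTheory.Automorphic.AutomorphicRepData.exists_lieDeriv_sub_smul_mem_rank_one
    (π : AutomorphicRepData (quasiSplitDatum F E c 1 hcpt)) (X : (quasiSplitDatum F E c 1 hcpt).arch.lie) :
    ∃ d : ℂ, ∀ φ ∈ π.W, lieDeriv (quasiSplitDatum F E c 1 hcpt).ofArch X φ - d • φ ∈ π.W' := by
  obtain ⟨φ₀, hφ₀W, hφ₀W'⟩ := SetLike.exists_of_lt π.lt
  have hsmooth : ∀ φ ∈ π.W, IsArchSmooth (quasiSplitDatum F E c 1 hcpt).ofArch φ :=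
    fun φ h => π.stable.isArchSmooth h
  have hφ₀form : IsAutomorphicForm (quasiSplitDatum F E c 1 hcpt) φ₀ := isAutomorphicForm_of_mem π.stable hφ₀W
  have hφ₀s := hφ₀form.archSmooth
  set V := zOrbitSpan (quasiSplitDatum F E c 1 hcpt).ofArch φ₀ with hV
  haveI : FiniteDimensional ℂ V := hφ₀form.zFinite
  have hVW : V ≤ π.W := Submodule.span_le.2 (by
    rintro _ ⟨p, -, rfl⟩
    exact π.stable.applyFree_mem p hφ₀W)
  have hVs : ∀ ψ ∈ V, IsArchSmooth (quasiSplitDatum F E c 1 hcpt).ofArch ψ :=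
    fun ψ hψ => isArchSmooth_of_mem_zOrbitSpan _ hφ₀s hψ
  have hVX : ∀ ψ ∈ V, lieDeriv (quasiSplitDatum F E c 1 hcpt).ofArch X ψ ∈ V :=
    fun ψ hψ => lieDeriv_mem_zOrbitSpan_of_forall_lie_eq_zero _ (lie_eq_zero_rank_one X) hφ₀s hψ
  obtain ⟨d, v, hvV, hvW', hv⟩ := exists_sub_smul_mem_of_finiteDimensional V π.W'
    (lieDeriv (quasiSplitDatum F E c 1 hcpt).ofArch X) hVX
    (fun v hv w hw => IsArchSmooth.lieDeriv_add _ X (hVs v hv) (hVs w hw))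
    (fun a v _ => lieDeriv_smul X a v) (fun v _ hv' => π.stable'.lie_stable X v hv')
    ⟨φ₀, mem_zOrbitSpan_self _ φ₀, hφ₀W'⟩
  refine ⟨d, π.forall_sub_smul_mem_of_exists (lieDeriv (quasiSplitDatum F E c 1 hcpt).ofArch X)
    (fun φ hφ => π.stable.lie_stable X φ hφ) (fun φ hφ => π.stable'.lie_stable X φ hφ)
    (fun φ hφ ψ hψ => IsArchSmooth.lieDeriv_add _ X (hsmooth φ hφ) (hsmooth ψ hψ))
    (fun a φ _ => lieDeriv_smul X a φ)
    (fun h _ φ _ => lieDeriv_rightTranslation_rank_one X h φ)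
    (fun k φ _ => lieDeriv_rightTranslation_rank_one X _ φ)
    (fun Y φ hφ => lieDeriv_comm_of_lie_eq_zero _ (lie_eq_zero_rank_one X Y) (hsmooth φ hφ))
    (hVW hvV) hvW' hv⟩

/-- **Every one-parameter subgroup element `exp(tX)` of `U(1)_∞` acts by a scalar on `W / W'`**
(an eigenvector of `r(exp tX)` modulo `W'` exists in the finite-dimensional `exp(tX)`-stable
`Z(𝔤)`-orbit span of a form `φ₀ ∈ W ∖ W'`; irreducibility). Borel–Jacquet 1979, 4.6. [folklore] -/
theorem _root_.Literature.NumberTheory.Automorphic.AutomorphicRepData.exists_rightTranslation_ofArch_expMem_sub_smul_mem_rank_one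
    (π : AutomorphicRepData (quasiSplitDatum F E c 1 hcpt)) (X : (quasiSplitDatum F E c 1 hcpt).arch.lie) (t : ℝ) :
    ∃ a : ℂ, ∀ φ ∈ π.W,
      rightTranslation (quasiSplit F E c 1)
        ((quasiSplitDatum F E c 1 hcpt).ofArch ((quasiSplitDatum F E c 1 hcpt).arch.expMem (t • X))) φ - a • φ ∈ π.W' := by
  obtain ⟨φ₀, hφ₀W, hφ₀W'⟩ := SetLike.exists_of_lt π.lt
  have hφ₀form : IsAutomorphicForm (quasiSplitDatum F E c 1 hcpt) φ₀ := isAutomorphicForm_of_mem π.stable hφ₀W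
  have hφ₀s := hφ₀form.archSmooth
  set V := zOrbitSpan (quasiSplitDatum F E c 1 hcpt).ofArch φ₀ with hV
  haveI : FiniteDimensional ℂ V := hφ₀form.zFinite
  have hVW : V ≤ π.W := Submodule.span_le.2 (by
    rintro _ ⟨p, -, rfl⟩
    exact π.stable.applyFree_mem p hφ₀W)
  have hVs : ∀ ψ ∈ V, IsArchSmooth (quasiSplitDatum F E c 1 hcpt).ofArch ψ :=
    fun ψ hψ => isArchSmooth_of_mem_zOrbitSpan _ hφ₀s hψ
  have hVX : ∀ ψ ∈ V, lieDeriv (quasiSplitDatum F E c 1 hcpt).ofArch X ψ ∈ V :=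
    fun ψ hψ => lieDeriv_mem_zOrbitSpan_of_forall_lie_eq_zero _ (lie_eq_zero_rank_one X) hφ₀s hψ
  have hVt : ∀ ψ ∈ V, rightTranslation (quasiSplit F E c 1)
      ((quasiSplitDatum F E c 1 hcpt).ofArch ((quasiSplitDatum F E c 1 hcpt).arch.expMem (t • X))) ψ ∈ V :=
    fun ψ hψ => archTranslate_expMem_mem_of_lieDeriv_mem _ V hVs X hVX hψ t
  obtain ⟨a, v, hvV, hvW', hv⟩ := exists_sub_smul_mem_of_finiteDimensional V π.W'
    (rightTranslation (quasiSplit F E c 1)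
      ((quasiSplitDatum F E c 1 hcpt).ofArch ((quasiSplitDatum F E c 1 hcpt).arch.expMem (t • X)))) hVt
    (fun v _ w _ => map_add _ v w) (fun a v _ => map_smul _ a v)
    (fun v _ hv' => π.stable'.rightTranslation_ofArch_expMem_mem_rank_one X t hv')
    ⟨φ₀, mem_zOrbitSpan_self _ φ₀, hφ₀W'⟩
  exact ⟨a, π.forall_rightTranslation_sub_smul_mem_of_exists _
    (fun φ hφ => π.stable.rightTranslation_ofArch_expMem_mem_rank_one X t hφ)
    (fun φ hφ => π.stable'.rightTranslation_ofArch_expMem_mem_rank_one X t hφ)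
    (fun h _ => mul_comm_rank_one F E c _ _)
    (fun k' => mul_comm_rank_one F E c _ _) (fun Y φ => (lieDeriv_rightTranslation_rank_one Y _ φ).symm)
    (hVW hvV) hvW' hv⟩

end UnitaryGroup

/-! ### The scalar of `r(exp tX)` is `e^{t d(X)}` -/

namespace UnitaryGroup

variable {F E : Type} [Field F] [NumberField F] [Field E] [NumberField E] [Algebra F E]
  {c : E ≃ₐ[F] E} {hcpt : isCompact_glFiniteIntegralLevel 1 E}

set_option maxHeartbeats 400000 in
/-- **The one-parameter subgroup `exp(tX)` of `U(1)_∞` acts on `W / W'` by `e^{t d(X)}`**, where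
`d(X)` is the scalar by which the Lie derivative along `X` acts on `W / W'`: for an automorphic
representation `π = W / W'` of `U(1)_{E/F}(𝔸_F)`, if `X φ - d(X) φ ∈ W'` for all `φ ∈ W`, then
`r(exp tX) φ - e^{t d(X)} φ ∈ W'` for all `φ ∈ W`, `t ∈ ℝ`. (Verbatim the argument of the tree's
`GL₁` case, `AutomorphicRepsGLOneHeckeCharacter`: the scalar `f(t)` of `r(exp tX)` is
`Λ(r(exp tX) φ₀)` for `φ₀ ∈ W ∖ W'` and a functional `Λ` with `Λ φ₀ = 1`, `Λ(W') = 0`; on the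
`Z(𝔤)`-orbit span of `φ₀` the translates are matrix exponentials in a basis, so `f' = d(X) f`,
`f(0) = 1`.) Gelbart 1975, §2.A; Borel–Jacquet 1979, 4.6, 5.7; Borel 1997, 8.6.
[cite: Gelbart1975, §2.A] -/
theorem _root_.Literature.NumberTheory.Automorphic.AutomorphicRepData.rightTranslation_ofArch_expMem_sub_exp_smul_mem_rank_one
    (π : AutomorphicRepData (quasiSplitDatum F E c 1 hcpt)) (X : (quasiSplitDatum F E c 1 hcpt).arch.lie)
    {dX : ℂ} (hdX : ∀ φ ∈ π.W, lieDeriv (quasiSplitDatum F E c 1 hcpt).ofArch X φ - dX • φ ∈ π.W')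
    (t : ℝ) {φ : (quasiSplit F E c 1).Adelic → ℂ} (hφ : φ ∈ π.W) :
    rightTranslation (quasiSplit F E c 1) ((quasiSplitDatum F E c 1 hcpt).ofArch
        ((quasiSplitDatum F E c 1 hcpt).arch.expMem (t • X))) φ - Complex.exp (t * dX) • φ ∈ π.W' := by
  -- the scalar `f s` of `r(exp sX)`
  have hf0 := fun s : ℝ => π.exists_rightTranslation_ofArch_expMem_sub_smul_mem_rank_one X s
  choose f hf using hf0
  -- `φ₀ ∈ W ∖ W'` and a separating functional
  obtain ⟨φ₀, hφ₀W, hφ₀W'⟩ := SetLike.exists_of_lt π.lt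
  obtain ⟨Λ, hΛ₀, hΛW'⟩ := exists_linearMap_eq_one_of_notMem π.W' hφ₀W'
  have hΛscalar : ∀ (T : ((quasiSplit F E c 1).Adelic → ℂ) → ((quasiSplit F E c 1).Adelic → ℂ))
      (a : ℂ), (∀ ψ ∈ π.W, T ψ - a • ψ ∈ π.W') → ∀ ψ ∈ π.W, Λ (T ψ) = a * Λ ψ := by
    intro T a hT ψ hψ
    have h := hΛW' _ (hT ψ hψ)
    rw [map_sub, map_smul, smul_eq_mul, sub_eq_zero] at h
    exact h
  -- `F s = Λ (r(exp sX) φ₀) = f s`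
  have hFf : ∀ s : ℝ, Λ (rightTranslation (quasiSplit F E c 1) ((quasiSplitDatum F E c 1 hcpt).ofArch
      ((quasiSplitDatum F E c 1 hcpt).arch.expMem (s • X))) φ₀) = f s := fun s => by
    rw [hΛscalar _ _ (hf s) φ₀ hφ₀W, hΛ₀, mul_one]
  -- the finite-dimensional `Z(𝔤)`-orbit span of `φ₀`
  have hφ₀form : IsAutomorphicForm (quasiSplitDatum F E c 1 hcpt) φ₀ := isAutomorphicForm_of_mem π.stable hφ₀W
  have hφ₀s : IsArchSmooth (quasiSplitDatum F E c 1 hcpt).ofArch φ₀ := hφ₀form.archSmooth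
  generalize hV : zOrbitSpan (quasiSplitDatum F E c 1 hcpt).ofArch φ₀ = V
  have hφ₀V : φ₀ ∈ V := hV ▸ mem_zOrbitSpan_self _ φ₀
  haveI : FiniteDimensional ℂ V := hV ▸ hφ₀form.zFinite
  have hVs : ∀ ψ ∈ V, IsArchSmooth (quasiSplitDatum F E c 1 hcpt).ofArch ψ := fun ψ hψ =>
    isArchSmooth_of_mem_zOrbitSpan _ hφ₀s (hV ▸ hψ)
  have hVX : ∀ ψ ∈ V, lieDeriv (quasiSplitDatum F E c 1 hcpt).ofArch X ψ ∈ V := fun ψ hψ => by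
    rw [← hV] at hψ ⊢
    exact lieDeriv_mem_zOrbitSpan_of_forall_lie_eq_zero _ (lie_eq_zero_rank_one X) hφ₀s hψ
  obtain ⟨M, hMX, hME⟩ := exists_matrix_archTranslate_expMem_eq_sum (quasiSplitDatum F E c 1 hcpt).ofArch V hVs X hVX
  obtain ⟨b, hb⟩ : ∃ b : Module.Basis (Fin (Module.finrank ℂ V)) ℂ V, b = Module.finBasis ℂ V := ⟨_, rfl⟩
  rw [← hb] at hMX hME
  obtain ⟨a, ha⟩ : ∃ a : Fin (Module.finrank ℂ V) → ℂ, a = fun i => b.repr ⟨φ₀, hφ₀V⟩ i := ⟨_, rfl⟩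
  have hφ₀sum : φ₀ = ∑ i, a i • (b i : (quasiSplit F E c 1).Adelic → ℂ) := by
    have h := congrArg (fun v : V => (v : (quasiSplit F E c 1).Adelic → ℂ)) (b.sum_repr ⟨φ₀, hφ₀V⟩)
    simp only [AddSubmonoidClass.coe_finsetSum, SetLike.val_smul] at h
    rw [ha]
    exact h.symm
  -- translates of the basis: `r(exp sX) bᵢ = ∑ⱼ (e^{sM})ᵢⱼ bⱼ`
  have hMEr : ∀ (s : ℝ) (i : Fin (Module.finrank ℂ V)),
      rightTranslation (quasiSplit F E c 1) ((quasiSplitDatum F E c 1 hcpt).ofArch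
        ((quasiSplitDatum F E c 1 hcpt).arch.expMem (s • X))) (b i : (quasiSplit F E c 1).Adelic → ℂ) =
        ∑ j, exp (s • M) i j • (b j : (quasiSplit F E c 1).Adelic → ℂ) := fun s i => hME s i
  have htrans : ∀ s : ℝ, rightTranslation (quasiSplit F E c 1) ((quasiSplitDatum F E c 1 hcpt).ofArch
      ((quasiSplitDatum F E c 1 hcpt).arch.expMem (s • X))) φ₀ =
      ∑ i, a i • ∑ j, exp (s • M) i j • (b j : (quasiSplit F E c 1).Adelic → ℂ) := by
    intro s
    conv_lhs => rw [hφ₀sum]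
    rw [map_sum]
    refine Finset.sum_congr rfl fun i _ => ?_
    rw [map_smul, hMEr s i]
  obtain ⟨Lb, hLb⟩ : ∃ Lb : Fin (Module.finrank ℂ V) → ℂ,
      ∀ j, Lb j = Λ (b j : (quasiSplit F E c 1).Adelic → ℂ) := ⟨_, fun j => rfl⟩
  have hFsum : ∀ s : ℝ, f s = ∑ i, a i * ∑ j, exp (s • M) i j * Lb j := by
    intro s
    rw [← hFf s, htrans s, map_sum]
    refine Finset.sum_congr rfl fun i _ => ?_
    rw [map_smul, map_sum, smul_eq_mul]
    congr 1
    refine Finset.sum_congr rfl fun j _ => ?_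
    rw [map_smul, smul_eq_mul, hLb]
  -- `f` is differentiable with `f' = ∑ᵢ aᵢ ∑ⱼ (e^{sM} M)ᵢⱼ Λ(bⱼ)`
  have hfderiv : ∀ s : ℝ, HasDerivAt f (∑ i, a i * ∑ j, (exp (s • M) * M) i j * Lb j) s := by
    intro s
    have hinner : ∀ i, HasDerivAt (fun s : ℝ => ∑ j, exp (s • M) i j * Lb j)
        (∑ j, (exp (s • M) * M) i j * Lb j) s := by
      intro i
      have h := HasDerivAt.sum (u := Finset.univ) (A := fun j (s : ℝ) => exp (s • M) i j * Lb j)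
        (A' := fun j => (exp (s • M) * M) i j * Lb j) (x := s)
        (fun j _ => (hasDerivAt_exp_smul_apply M s i j).mul_const (Lb j))
      have hfun : (fun s : ℝ => ∑ j, exp (s • M) i j * Lb j) =
          ∑ j ∈ Finset.univ, (fun j (s : ℝ) => exp (s • M) i j * Lb j) j := by
        funext s'
        rw [Finset.sum_apply]
      rw [hfun]
      exact h
    have h := HasDerivAt.sum (u := Finset.univ)
      (A := fun i (s : ℝ) => a i * ∑ j, exp (s • M) i j * Lb j)
      (A' := fun i => a i * ∑ j, (exp (s • M) * M) i j * Lb j) (x := s)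
      (fun i _ => (hinner i).const_mul (a i))
    have hfeq : f = ∑ i ∈ Finset.univ, (fun i (s : ℝ) => a i * ∑ j, exp (s • M) i j * Lb j) i := by
      funext s
      rw [Finset.sum_apply]
      exact hFsum s
    rw [hfeq]
    exact h
  -- the derivative is `d(X) f`: compute `Λ (r(exp sX) (X φ₀))` in two ways
  have hXφ₀ : lieDeriv (quasiSplitDatum F E c 1 hcpt).ofArch X φ₀ =
      ∑ i, a i • ∑ k, M i k • (b k : (quasiSplit F E c 1).Adelic → ℂ) := by
    conv_lhs => rw [hφ₀sum]
    rw [lieDeriv_sum_smul_of_isArchSmooth (quasiSplitDatum F E c 1 hcpt).ofArch X a _ (fun i => hVs _ (b i).2)]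
    refine Finset.sum_congr rfl fun i _ => ?_
    rw [hMX i]
  have hderiv_eq : ∀ s : ℝ, (∑ i, a i * ∑ j, (exp (s • M) * M) i j * Lb j) = dX * f s := by
    intro s
    have hw' : lieDeriv (quasiSplitDatum F E c 1 hcpt).ofArch X φ₀ - dX • φ₀ ∈ π.W' := hdX φ₀ hφ₀W
    have hA : Λ (rightTranslation (quasiSplit F E c 1) ((quasiSplitDatum F E c 1 hcpt).ofArch
        ((quasiSplitDatum F E c 1 hcpt).arch.expMem (s • X))) (lieDeriv (quasiSplitDatum F E c 1 hcpt).ofArch X φ₀)) = dX * f s := by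
      have hlin : rightTranslation (quasiSplit F E c 1) ((quasiSplitDatum F E c 1 hcpt).ofArch
          ((quasiSplitDatum F E c 1 hcpt).arch.expMem (s • X))) (lieDeriv (quasiSplitDatum F E c 1 hcpt).ofArch X φ₀ - dX • φ₀) =
          rightTranslation (quasiSplit F E c 1) ((quasiSplitDatum F E c 1 hcpt).ofArch
            ((quasiSplitDatum F E c 1 hcpt).arch.expMem (s • X))) (lieDeriv (quasiSplitDatum F E c 1 hcpt).ofArch X φ₀) -
            dX • rightTranslation (quasiSplit F E c 1) ((quasiSplitDatum F E c 1 hcpt).ofArch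
              ((quasiSplitDatum F E c 1 hcpt).arch.expMem (s • X))) φ₀ :=
        funext fun _ => rfl
      have e := congrArg Λ hlin
      rw [hΛW' _ (π.stable'.rightTranslation_ofArch_expMem_mem_rank_one X s hw'), map_sub, map_smul,
        smul_eq_mul, hFf s] at e
      exact (sub_eq_zero.1 e.symm)
    have hB : Λ (rightTranslation (quasiSplit F E c 1) ((quasiSplitDatum F E c 1 hcpt).ofArch
        ((quasiSplitDatum F E c 1 hcpt).arch.expMem (s • X))) (lieDeriv (quasiSplitDatum F E c 1 hcpt).ofArch X φ₀)) =
        ∑ i, a i * ∑ j, (M * exp (s • M)) i j * Lb j := by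
      rw [hXφ₀, map_sum, map_sum]
      refine Finset.sum_congr rfl fun i _ => ?_
      rw [map_smul, map_smul, smul_eq_mul, map_sum, map_sum]
      congr 1
      rw [← sum_mul_sum_mul_eq_sum_mul_apply]
      refine Finset.sum_congr rfl fun k _ => ?_
      rw [map_smul, map_smul, smul_eq_mul, hMEr s k, map_sum]
      congr 1
      refine Finset.sum_congr rfl fun j _ => ?_
      rw [map_smul, smul_eq_mul, hLb]
    rw [← hA, hB]
    simp only [mul_exp_smul_comm]
  have hf' : ∀ s : ℝ, HasDerivAt f (dX * f s) s := fun s => (hfderiv s).congr_deriv (hderiv_eq s)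
  have hf0' : f 0 = 1 := by
    have h00 := hFf 0
    have hone : (quasiSplitDatum F E c 1 hcpt).ofArch ((quasiSplitDatum F E c 1 hcpt).arch.expMem ((0 : ℝ) • X)) = 1 := by
      rw [zero_smul, RealMatrixGroup.expMem_zero', map_one]
    have hr1 : rightTranslation (quasiSplit F E c 1) (1 : (quasiSplit F E c 1).Adelic) φ₀ = φ₀ :=
      funext fun g => by rw [rightTranslation_apply, mul_one]
    rw [hone, hr1, hΛ₀] at h00
    exact h00.symm
  have hfexp : f t = Complex.exp (dX * t) := eq_exp_of_hasDerivAt_mul hf' hf0' t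
  have := hf t φ hφ
  rw [hfexp, mul_comm dX (t : ℂ)] at this
  exact this

end UnitaryGroup

/-! ### The archimedean torus `U(1)_∞`: the form, the logarithm `Y ↦ Y - (c ⊗ 1) Y`, and the
identity `z/z̄ = exp(Y - Ȳ)` for `z = exp Y` -/

namespace UnitaryGroup

variable {F E : Type} [Field F] [NumberField F] [Field E] [NumberField E] [Algebra F E]
  {c : E ≃ₐ[F] E} {hcpt : isCompact_glFiniteIntegralLevel 1 E}

omit [NumberField F] [NumberField E] in
/-- Mok's form in rank one is `J₁ = (1)`. [cite: Mok2014, §1 Notation p. 5] -/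
theorem archForm_rank_one : archForm E 1 (StdForm.antidiagonal 1) = 1 := by
  refine Matrix.ext fun i j => ?_
  rw [Subsingleton.elim i 0, Subsingleton.elim j 0, Matrix.one_apply_eq]
  change ((StdForm.antidiagonal 1).J.map (Int.castRingHom (mixedSpace E))) 0 0 = 1
  rw [Matrix.map_apply, StdForm.antidiagonal_J_apply, if_pos (Subsingleton.elim _ _), map_one]

omit [NumberField F] in
/-- `1 × 1` matrices are symmetric. [folklore] -/
theorem transpose_fin_one {R : Type*} (M : Matrix (Fin 1) (Fin 1) R) : Mᵀ = M := by
  ext i j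
  rw [Matrix.transpose_apply, Subsingleton.elim i j]

omit [NumberField F] in
/-- `1 × 1` matrices commute. [folklore] -/
theorem commute_fin_one {R : Type*} [CommSemiring R] (A B : Matrix (Fin 1) (Fin 1) R) : Commute A B := by
  refine Matrix.ext fun i j => ?_
  rw [Subsingleton.elim i 0, Subsingleton.elim j 0]
  simp [Matrix.mul_apply, mul_comm]

omit [NumberField F] [NumberField E] in
/-- `(c ⊗ 1)² = 1` on `E ⊗ ℝ` for an involution `c`. [folklore] -/
theorem conjMixed_conjMixed (hc : c * c = 1) (x : mixedSpace E) : conjMixed F E c (conjMixed F E c x) = x := by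
  have hinv : c⁻¹ = c := inv_eq_of_mul_eq_one_right hc
  have h := conjMixed_inv_apply F E c x
  rwa [hinv] at h

omit [NumberField F] [NumberField E] in
/-- `Y - (c ⊗ 1) Y ∈ 𝔲(1) = {X | (c ⊗ 1) X + X = 0}` for every `Y ∈ 𝔤𝔩₁(E ⊗ ℝ)` (`c² = 1`). [folklore] -/
theorem sub_map_conjMixed_mem_archLie (hc : c * c = 1) (Y : Matrix (Fin 1) (Fin 1) (mixedSpace E)) :
    Y - Y.map (conjMixed F E c) ∈ archLie F E c 1 (StdForm.antidiagonal 1) := by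
  rw [mem_archLie_iff, archForm_rank_one, Matrix.mul_one, Matrix.one_mul, transpose_fin_one,
    Matrix.map_sub _ (map_sub _), Matrix.map_map]
  have hid : (conjMixed F E c ∘ conjMixed F E c : mixedSpace E → mixedSpace E) = id :=
    funext fun x => conjMixed_conjMixed hc x
  rw [hid, Matrix.map_id]
  abel

variable (F E c hcpt) in
/-- **The logarithm of `U(1)_∞` through `GL₁(E ⊗ ℝ)`**: the real-linear map
`Y ↦ Y - (c ⊗ 1) Y : 𝔤𝔩₁(E ⊗ ℝ) → 𝔲(1)` (the Lie algebra of the archimedean group of the `U(1)`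
datum), for which `exp(Y)/\overline{exp(Y)} = exp(Y - (c ⊗ 1) Y)` (`toNormOne_det_ofInfinite_expGL`). [folklore] -/
def archLog (hc : c * c = 1) : Matrix (Fin 1) (Fin 1) (mixedSpace E) →ₗ[ℝ] (quasiSplitDatum F E c 1 hcpt).arch.lie where
  toFun Y := ⟨Y - Y.map (conjMixed F E c), sub_map_conjMixed_mem_archLie hc Y⟩
  map_add' Y Z := Subtype.ext (by
    change Y + Z - (Y + Z).map (conjMixed F E c) = (Y - Y.map (conjMixed F E c)) + (Z - Z.map (conjMixed F E c))
    rw [Matrix.map_add _ (map_add _)]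
    abel)
  map_smul' t Y := Subtype.ext (by
    change t • Y - (t • Y).map (conjMixed F E c) = t • (Y - Y.map (conjMixed F E c))
    rw [Matrix.map_smul _ _ (conjMixed_real_smul F E c t), smul_sub])

/-- The matrix of `archLog Y` is `Y - (c ⊗ 1) Y` (definitional). [folklore] -/
@[simp] theorem coe_archLog (hc : c * c = 1) (Y : Matrix (Fin 1) (Fin 1) (mixedSpace E)) :
    ((archLog F E c hcpt hc Y : (quasiSplitDatum F E c 1 hcpt).arch.lie) : Matrix (Fin 1) (Fin 1) (mixedSpace E)) =
      Y - Y.map (conjMixed F E c) := rfl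

omit [NumberField F] in
/-- **`c ⊗ 1` on `GL_N(𝔸_E)` and the archimedean embedding**: `(c ⊗ 1)(g, 1) = ((c ⊗ 1) g, 1)`. [folklore] -/
theorem map_conjAdele_ofInfinite {N : ℕ} (g : GL (Fin N) (mixedSpace E)) :
    Matrix.GeneralLinearGroup.map (conjAdele F E c) (GLn.ofInfinite N E g) =
      GLn.ofInfinite N E (Matrix.GeneralLinearGroup.map (conjMixed F E c) g) := by
  refine Matrix.GeneralLinearGroup.ext fun i j => ?_
  have hval : (Matrix.GeneralLinearGroup.map (conjMixed F E c) g).val = g.val.map (conjMixed F E c) :=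
    Matrix.ext fun i j => Matrix.GeneralLinearGroup.map_apply _ _ _ _
  have key : ((GLn.ofInfinite N E g).val.map (conjAdele F E c)) =
      (GLn.ofInfinite N E (Matrix.GeneralLinearGroup.map (conjMixed F E c) g)).val := by
    set e' := (InfiniteAdeleRing.ringEquiv_mixedSpace E).symm.toRingHom with he'
    refine matrix_adele_ext E N ?_ ?_
    · rw [Matrix.map_map,
        show (adeleFst E ∘ conjAdele F E c : AdeleRing (𝓞 E) E → InfiniteAdeleRing E) =
          (MulSemiringAction.toRingHom (E ≃ₐ[F] E) (InfiniteAdeleRing E) c) ∘ adeleFst E from rfl,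
        ← Matrix.map_map, map_fst_ofInfinite, map_fst_ofInfinite, Matrix.map_map, hval, Matrix.map_map]
      congr 1
      funext x
      exact (ringEquiv_symm_conjMixed F E c x).symm
    · rw [Matrix.map_map,
        show (adeleSnd E ∘ conjAdele F E c : AdeleRing (𝓞 E) E → FiniteAdeleRing (𝓞 E) E) =
          (MulSemiringAction.toRingHom (E ≃ₐ[F] E) (FiniteAdeleRing (𝓞 E) E) c) ∘ adeleSnd E from rfl,
        ← Matrix.map_map, map_snd_ofInfinite, map_snd_ofInfinite, Matrix.map_one _ (map_zero _) (map_one _)]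
  rw [Matrix.GeneralLinearGroup.map_apply]
  exact congrFun (congrFun key i) j

omit [NumberField F] in
/-- `c ⊗ 1` commutes with the exponential of `GL_N(E ⊗ ℝ)` (`map_conjMixed_exp`). [folklore] -/
theorem map_conjMixed_expGL {N : ℕ} (Y : Matrix (Fin N) (Fin N) (mixedSpace E)) :
    Matrix.GeneralLinearGroup.map (conjMixed F E c) (expGL Y) = expGL (Y.map (conjMixed F E c)) :=
  Units.ext (Matrix.ext fun i j => by
    rw [Matrix.GeneralLinearGroup.map_apply, coe_expGL, coe_expGL, ← map_conjMixed_exp, Matrix.map_apply])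

omit [NumberField F] in
/-- `exp (Y - Z) = exp Y (exp Z)⁻¹` in `GL₁(E ⊗ ℝ)` (`1 × 1` matrices commute). [folklore] -/
theorem expGL_sub_fin_one (Y Z : Matrix (Fin 1) (Fin 1) (mixedSpace E)) :
    expGL (Y - Z) = expGL Y * (expGL Z)⁻¹ := by
  have h1 : expGL (Y - Z) = expGL Y * expGL (-Z) := Units.ext (by
    rw [Units.val_mul, coe_expGL, coe_expGL, coe_expGL, sub_eq_add_neg]
    exact Matrix.exp_add_of_commute _ _ (commute_fin_one Y (-Z)))
  have h2 : expGL (-Z) * expGL Z = 1 := Units.ext (by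
    rw [Units.val_mul, coe_expGL, coe_expGL, Units.val_one]
    exact exp_neg_mul_exp E 1 Z)
  rw [h1, eq_inv_of_mul_eq_one_left h2]

omit [NumberField F] in
/-- `c ⊗ 1` on idèles versus determinants: `(c ⊗ 1)(det g) = det ((c ⊗ 1) g)`. [folklore] -/
theorem conjIdele_det {N : ℕ} (g : GL (Fin N) (AdeleRing (𝓞 E) E)) :
    conjIdele F E c (Matrix.GeneralLinearGroup.det g) =
      Matrix.GeneralLinearGroup.det (Matrix.GeneralLinearGroup.map (conjAdele F E c) g) := by
  rw [Matrix.GeneralLinearGroup.map_det]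
  rfl

/-- **`z/\bar z = exp(Y - \bar Y)` for `z = exp Y`**: under `toNormOne : 𝕀_E → U(1)(𝔸_F)`, the
archimedean exponential idèle `det (exp Y, 1)` (`Y ∈ 𝔤𝔩₁(E ⊗ ℝ)`) goes to the one-parameter
element `exp (Y - (c ⊗ 1) Y)` of `U(1)_∞ ⊂ U(1)(𝔸_F)` (`c² = 1`; `1 × 1` matrices commute and `c ⊗ 1`
commutes with `exp`). Tate (1967), Ch. VII §1.1; Borel–Jacquet 1979, §4.1. [folklore] -/
theorem toNormOne_det_ofInfinite_expGL (hc : c * c = 1) (Y : Matrix (Fin 1) (Fin 1) (mixedSpace E)) :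
    toNormOne F E c hc (Matrix.GeneralLinearGroup.det (GLn.ofInfinite 1 E (expGL Y))) =
      (quasiSplitDatum F E c 1 hcpt).ofArch ((quasiSplitDatum F E c 1 hcpt).arch.expMem (archLog F E c hcpt hc Y)) := by
  apply adelicVal_injective F E c 1
  rw [adelicVal_toNormOne, map_mul, map_inv, generalLinearGroup_scalar_det_of_fin_one, conjIdele_det,
    generalLinearGroup_scalar_det_of_fin_one, map_conjAdele_ofInfinite, map_conjMixed_expGL, ← map_inv,
    ← map_mul, ← expGL_sub_fin_one]
  rfl

omit [NumberField F] in
/-- Entrywise conjugation of the scalar matrix `a · 1 ∈ 𝔤𝔩₁(ℂ)`. [folklore] -/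
theorem smul_one_map_starRingEnd (a : ℂ) :
    (a • (1 : Matrix (Fin 1) (Fin 1) ℂ)).map (starRingEnd ℂ) = (starRingEnd ℂ a) • (1 : Matrix (Fin 1) (Fin 1) ℂ) := by
  ext i j
  rw [Subsingleton.elim i 0, Subsingleton.elim j 0]
  simp

/-- **`archLog` on the complex factor at a place fixed by `c ≠ 1`**: `archLog (a · 1_w) = (a - ā) · 1_w`
(`c ⊗ 1` is complex conjugation on that factor, `map_conjMixed_complexPlaceLie`). [folklore] -/
theorem coe_archLog_complexPlaceLie (hc : c * c = 1) {w : {w : InfinitePlace E // w.IsComplex}}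
    (hw : c • w.1 = w.1) (hc1 : c ≠ 1) (a : ℂ) :
    ((archLog F E c hcpt hc (complexPlaceLie 1 w (a • (1 : Matrix (Fin 1) (Fin 1) ℂ))) :
        (quasiSplitDatum F E c 1 hcpt).arch.lie) : Matrix (Fin 1) (Fin 1) (mixedSpace E)) =
      complexPlaceLie 1 w ((a - starRingEnd ℂ a) • (1 : Matrix (Fin 1) (Fin 1) ℂ)) := by
  rw [coe_archLog, map_conjMixed_complexPlaceLie 1 hw hc1, smul_one_map_starRingEnd, ← map_sub, ← sub_smul]

omit [NumberField F] in
/-- `exp (2πi · 1_w) = 1` in `GL₁(E ⊗ ℝ)`. [folklore] -/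
theorem expGL_complexPlaceLie_two_pi_I (w : {w : InfinitePlace E // w.IsComplex}) :
    expGL (complexPlaceLie 1 w (((2 * Real.pi : ℂ) * Complex.I) • (1 : Matrix (Fin 1) (Fin 1) ℂ))) = 1 := by
  refine Units.ext (Matrix.ext fun i j => ?_)
  rw [Subsingleton.elim i 0, Subsingleton.elim j 0, expGL_fin_one_apply, complexPlaceLie_smul_one_apply,
    Units.val_one, Matrix.one_apply_eq]
  refine Prod.ext ?_ ?_
  · rw [Prod.fst_exp, NormedSpace.exp_zero]; rfl
  · rw [Prod.snd_exp]
    funext w'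
    rw [Pi.coe_exp]
    change NormedSpace.exp ((Pi.single w ((2 * Real.pi : ℂ) * Complex.I) : {w : InfinitePlace E // w.IsComplex} → ℂ) w') = 1
    by_cases h : w' = w
    · subst h
      rw [Pi.single_eq_same, ← congrFun Complex.exp_eq_exp_ℂ, Complex.exp_two_pi_mul_I]
    · rw [Pi.single_eq_of_ne h, NormedSpace.exp_zero]

/-- **Periodicity of the one-parameter subgroups of `U(1)_∞`**: `exp (archLog (πi · 1_w)) = 1` at a
complex place `w` fixed by `c ≠ 1` (`archLog (πi · 1_w) = 2πi · 1_w`). [folklore] -/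
theorem ofArch_expMem_archLog_pi_I (hc : c * c = 1) {w : {w : InfinitePlace E // w.IsComplex}}
    (hw : c • w.1 = w.1) (hc1 : c ≠ 1) :
    (quasiSplitDatum F E c 1 hcpt).ofArch ((quasiSplitDatum F E c 1 hcpt).arch.expMem
      (archLog F E c hcpt hc (complexPlaceLie 1 w (((Real.pi : ℂ) * Complex.I) • (1 : Matrix (Fin 1) (Fin 1) ℂ))))) = 1 := by
  rw [← (quasiSplitDatum F E c 1 hcpt).ofArch.map_one]
  congr 1
  apply Subtype.ext
  rw [RealMatrixGroup.coe_expMem, coe_archLog_complexPlaceLie hc hw hc1, OneMemClass.coe_one]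
  have h2 : ((Real.pi : ℂ) * Complex.I) - starRingEnd ℂ ((Real.pi : ℂ) * Complex.I) = (2 * Real.pi : ℂ) * Complex.I := by
    rw [map_mul, Complex.conj_ofReal, Complex.conj_I]
    ring
  rw [h2]
  exact expGL_complexPlaceLie_two_pi_I w

end UnitaryGroup

/-! ### The Hecke character of an automorphic representation of `U(1)_{E/F}` -/

namespace UnitaryGroup

open Literature.NumberTheory.GaloisRepresentations (HeckeCharacter)

variable {F E : Type} [Field F] [NumberField F] [Field E] [NumberField E] [Algebra F E]
  {c : E ≃ₐ[F] E} {hcpt : isCompact_glFiniteIntegralLevel 1 E}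

/-- An element of `U(1)(𝔸_F)` with trivial archimedean part lies in `U(1)(𝔸_F^∞)`
(`g = (g_∞, 1)(1, g_f)`, `GLn.ofInfinite_toMixed_mul_ofFinite_sndHom`). [folklore] -/
theorem mem_finiteAdelic_of_fstHom_eq_one {g : (quasiSplit F E c 1).Adelic}
    (h : GLn.fstHom 1 E (adelicVal F E c 1 _ g) = 1) : g ∈ (quasiSplitDatum F E c 1 hcpt).finiteAdelic := by
  change adelicVal F E c 1 _ g ∈ (GLn.ofFinite 1 E).range
  refine ⟨GLn.sndHom 1 E (adelicVal F E c 1 _ g), ?_⟩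
  have key := GLn.ofInfinite_toMixed_mul_ofFinite_sndHom (n := 1) (K := E) (adelicVal F E c 1 _ g)
  rwa [GLn.toMixed_apply, h, map_one, map_one, one_mul] at key

/-- `toNormOne (x at v) ∈ U(1)(𝔸_F^∞)`. [folklore] -/
theorem toNormOne_localUnits_mem_finiteAdelic {hc : c * c = 1} (v : HeightOneSpectrum (𝓞 E))
    (x : (v.adicCompletion E)ˣ) :
    toNormOne F E c hc (localUnits v x) ∈ (quasiSplitDatum F E c 1 hcpt).finiteAdelic :=
  mem_finiteAdelic_of_fstHom_eq_one (fstHom_adelicVal_toNormOne_localUnits v x)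

omit [NumberField F] in
/-- **`c ⊗ 1` on `GL_N(𝔸_E)` and the finite embedding**: `(c ⊗ 1)(1, u) = (1, (c ⊗ 1) u)`. [folklore] -/
theorem map_conjAdele_ofFinite {N : ℕ} (u : GL (Fin N) (FiniteAdeleRing (𝓞 E) E)) :
    Matrix.GeneralLinearGroup.map (conjAdele F E c) (GLn.ofFinite N E u) =
      GLn.ofFinite N E (Matrix.GeneralLinearGroup.map
        (MulSemiringAction.toRingHom (E ≃ₐ[F] E) (FiniteAdeleRing (𝓞 E) E) c) u) := by
  refine GLn.ext_of_fstHom_of_sndHom ?_ ?_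
  · rw [GLn.fstHom_ofFinite]
    refine Matrix.GeneralLinearGroup.ext fun i j => ?_
    change c • ((GLn.ofFinite N E u : Matrix (Fin N) (Fin N) (AdeleRing (𝓞 E) E)) i j).1 =
      ((1 : GL (Fin N) (InfiniteAdeleRing E)) : Matrix (Fin N) (Fin N) (InfiniteAdeleRing E)) i j
    rw [GLn.coe_ofFinite_apply, Units.val_one, Matrix.one_apply]
    split_ifs
    · exact smul_one c
    · exact smul_zero c
  · rw [GLn.sndHom_ofFinite]
    refine Matrix.GeneralLinearGroup.ext fun i j => ?_
    change c • ((GLn.ofFinite N E u : Matrix (Fin N) (Fin N) (AdeleRing (𝓞 E) E)) i j).2 =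
      c • ((u : Matrix (Fin N) (Fin N) (FiniteAdeleRing (𝓞 E) E)) i j)
    rw [GLn.coe_ofFinite_apply]

/-- **`toNormOne` of a finite idèle `det (1, u)`** is `(1, u · ((c ⊗ 1) u)⁻¹)`. [folklore] -/
theorem adelicVal_toNormOne_det_ofFinite (hc : c * c = 1) (u : GL (Fin 1) (FiniteAdeleRing (𝓞 E) E)) :
    adelicVal F E c 1 _ (toNormOne F E c hc (Matrix.GeneralLinearGroup.det (GLn.ofFinite 1 E u))) =
      GLn.ofFinite 1 E (u * (Matrix.GeneralLinearGroup.map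
        (MulSemiringAction.toRingHom (E ≃ₐ[F] E) (FiniteAdeleRing (𝓞 E) E) c) u)⁻¹) := by
  rw [adelicVal_toNormOne, map_mul, map_inv, generalLinearGroup_scalar_det_of_fin_one, conjIdele_det,
    generalLinearGroup_scalar_det_of_fin_one, map_conjAdele_ofFinite, ← map_inv, ← map_mul]

/-- **Rational points**: `toNormOne` of a principal idèle `x ∈ Eˣ` is the image of the rational
point `x · c(x)⁻¹ ∈ U(1)(F)` (`c² = 1`). [folklore] -/
theorem toNormOne_principal_mem_arithmeticSubgroup (hc : c * c = 1) (x : Eˣ) :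
    toNormOne F E c hc (Units.map (algebraMap E (AdeleRing (𝓞 E) E) : E →* AdeleRing (𝓞 E) E) x) ∈
      (quasiSplit F E c 1).arithmeticSubgroup := by
  set y : Eˣ := x * (Units.map ((c : E →+* E) : E →* E) x)⁻¹ with hy
  have hymem : Units.map (Matrix.scalar (Fin 1) : E →+* Matrix (Fin 1) (Fin 1) E).toMonoidHom y ∈
      rational F E c 1 ((StdForm.antidiagonal 1).over E) := by
    refine scalar_mem_unitaryGroupOfForm _ _ _ ?_
    have h1 : (c : E →+* E) (y : E) = ((Units.map ((c : E →+* E) : E →* E) x * x⁻¹ : Eˣ) : E) := by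
      rw [hy, Units.val_mul, map_mul, Units.val_mul]
      congr 1
      rw [Units.val_inv_eq_inv_val, Units.val_inv_eq_inv_val, map_inv₀, Units.coe_map, MonoidHom.coe_coe]
      congr 1
      change (c * c) (x : E) = x
      rw [hc, AlgEquiv.one_apply]
    rw [h1, ← Units.val_mul]
    have h2 : Units.map ((c : E →+* E) : E →* E) x * x⁻¹ * y = 1 := by rw [hy]; group
    rw [h2, Units.val_one]
  refine ⟨⟨_, hymem⟩, ?_⟩
  apply adelicVal_injective F E c 1
  rw [adelicVal_toNormOne]
  change Matrix.GeneralLinearGroup.map (algebraMap E (AdeleRing (𝓞 E) E))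
    (Matrix.GeneralLinearGroup.scalar (Fin 1) y) = _
  have hconj : conjIdele F E c (Units.map (algebraMap E (AdeleRing (𝓞 E) E) : E →* AdeleRing (𝓞 E) E) x) =
      Units.map (algebraMap E (AdeleRing (𝓞 E) E) : E →* AdeleRing (𝓞 E) E)
        (Units.map ((c : E →+* E) : E →* E) x) :=
    Units.ext (algebraMap_conj F E c x).symm
  rw [Matrix.GeneralLinearGroup.map_scalar, hy, map_mul, map_inv, hconj]

/-- **Finite elements with an eigenvector act by scalars on `U(1)`-representations**: if
`h ∈ U(1)(𝔸_F^∞)` has an eigenvector `φ₀ ∈ W ∖ W'` modulo `W'`, it lies in the scalar subgroup of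
`π` (commutativity makes `r(h)` an intertwiner, `forall_rightTranslation_sub_smul_mem_of_exists`).
Borel–Jacquet 1979, 4.6. [folklore] -/
theorem mem_scalarSubgroup_of_mem_finiteAdelic (π : AutomorphicRepData (quasiSplitDatum F E c 1 hcpt))
    {h : (quasiSplit F E c 1).Adelic} (hh : h ∈ (quasiSplitDatum F E c 1 hcpt).finiteAdelic)
    {φ₀ : (quasiSplit F E c 1).Adelic → ℂ} (hφ₀ : φ₀ ∈ π.W) (hφ₀' : φ₀ ∉ π.W') {a : ℂ}
    (h₀ : rightTranslation (quasiSplit F E c 1) h φ₀ - a • φ₀ ∈ π.W') : h ∈ π.scalarSubgroup := by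
  have hW : ∀ g ∈ (quasiSplitDatum F E c 1 hcpt).finiteAdelic, ∀ φ ∈ π.W,
      rightTranslation (quasiSplit F E c 1) g φ ∈ π.W := fun g hg φ hφ => π.stable.finite_stable g hg hφ
  have hW' : ∀ g ∈ (quasiSplitDatum F E c 1 hcpt).finiteAdelic, ∀ φ ∈ π.W',
      rightTranslation (quasiSplit F E c 1) g φ ∈ π.W' := fun g hg φ hφ => π.stable'.finite_stable g hg hφ
  have hscalar := π.forall_rightTranslation_sub_smul_mem_of_exists h (hW h hh) (hW' h hh)
    (fun g _ => mul_comm_rank_one F E c g h) (fun k => mul_comm_rank_one F E c _ h)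
    (fun X φ => (lieDeriv_rightTranslation_rank_one X h φ).symm) hφ₀ hφ₀' h₀
  exact π.mem_scalarSubgroup_of_actsByScalar ⟨hW h hh, hW' h hh, a, hscalar⟩
    (hW h⁻¹ (Subgroup.inv_mem _ hh)) (hW' h⁻¹ (Subgroup.inv_mem _ hh))

/-- Inverses of one-parameter elements: `exp(tX)⁻¹ = exp(-tX)` in `U(1)(𝔸_F)`. [folklore] -/
theorem ofArch_expMem_smul_inv (X : (quasiSplitDatum F E c 1 hcpt).arch.lie) (t : ℝ) :
    ((quasiSplitDatum F E c 1 hcpt).ofArch ((quasiSplitDatum F E c 1 hcpt).arch.expMem (t • X)))⁻¹ =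
      (quasiSplitDatum F E c 1 hcpt).ofArch ((quasiSplitDatum F E c 1 hcpt).arch.expMem ((-t) • X)) := by
  rw [← map_inv]
  congr 1
  rw [eq_comm, eq_inv_iff_mul_eq_one]
  apply Subtype.ext
  rw [Subgroup.coe_mul, RealMatrixGroup.coe_expMem, RealMatrixGroup.coe_expMem, OneMemClass.coe_one]
  change expGL ((-t) • (X : Matrix (Fin 1) (Fin 1) (mixedSpace E))) *
    expGL (t • (X : Matrix (Fin 1) (Fin 1) (mixedSpace E))) = 1
  rw [neg_smul]
  refine Units.ext ?_
  rw [Units.val_mul, coe_expGL, coe_expGL, Units.val_one]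
  exact exp_neg_mul_exp E 1 _

set_option maxHeartbeats 800000 in
/-- **The Hecke character of an automorphic representation of `U(1)_{E/F}` (Borel–Jacquet model).**
Let `E/F` be a quadratic extension of number fields with non-trivial automorphism `c` (`c² = 1`) and
`π = W / W'` an automorphic representation datum of the norm-one torus
`U(1)_{E/F} = U(J₁)`, `U(1)(𝔸_F) = {z ∈ 𝕀_E | z c(z) = 1}`. There are

* the character `ω : H_π →* ℂˣ` of the subgroup `H_π ≤ U(1)(𝔸_F)` of elements acting by scalars on
  `W / W'` (`AutomorphicRepData.exists_monoidHom_scalarSubgroup`),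
* a **Hecke character `ψ` of `E`** with `ψ(z) = ω(z / c(z))` whenever `z / c(z) ∈ H_π`
  (`toNormOne z = z · c(z)⁻¹`, Hilbert 90 direction `𝕀_E → U(1)(𝔸_F)`), and
* the infinitesimal character `d : 𝔲(1)_∞ → ℂ` (real linear), `X φ ≡ d(X) φ (mod W')`,

such that `ψ(det (exp Y, 1)) = e^{d(Y - (c ⊗ 1) Y)}` for every `Y ∈ 𝔤𝔩₁(E ⊗ ℝ)` and `e^{d(X)} = 1`
whenever `exp X = 1` in `U(1)_∞`. Construction: `ω ∘ toNormOne` on `toNormOne⁻¹(H_π)` extends to a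
character `ψ` of `𝕀_E` because `ℂˣ` is divisible (`MonoidHom.exists_extend_unitsComplex`); `ψ` is
trivial on `Eˣ` (`x / c(x) ∈ U(1)(F)` acts trivially by left invariance and commutativity), trivial
on an open subgroup of finite idèles (those `(1, u)` with `u, c(u)` in the level of a form
`φ₀ ∈ W ∖ W'`), and its archimedean slices are `Y ↦ ψ(g₀) e^{d(Y - (c ⊗ 1)Y)}`
(`toNormOne_det_ofInfinite_expGL`, `rightTranslation_ofArch_expMem_sub_exp_smul_mem_rank_one`), hence
`ψ` is continuous (`continuousAt_of_continuousAt_archSlice`). This is the rank-one (abelian) case of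
the dictionary "automorphic representations of `U(1)` = characters of `E¹ \ 𝔸_E¹`", pulled back to
idèle class characters of `E`. Gelbart 1975, §2.A and §6.A (the `GL(1)` model); Borel–Jacquet 1979,
4.6; Rogawski 1990, §11.3 (characters of `U(1)`); Mok 2014, §1 and Thm. 2.5.1 (`N = 1`).
[cite: Gelbart1975, §2.A] [cite: BorelJacquet1979, 4.6] -/
theorem _root_.Literature.NumberTheory.Automorphic.AutomorphicRepData.exists_heckeCharacter_rank_one
    (hc : c * c = 1) (π : AutomorphicRepData (quasiSplitDatum F E c 1 hcpt)) :
    ∃ (ω : π.scalarSubgroup →* ℂˣ) (ψ : HeckeCharacter E)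
      (d : (quasiSplitDatum F E c 1 hcpt).arch.lie →ₗ[ℝ] ℂ),
      (∀ (g : π.scalarSubgroup), ∀ φ ∈ π.W,
        rightTranslation (quasiSplit F E c 1) (g : (quasiSplit F E c 1).Adelic) φ - ((ω g : ℂˣ) : ℂ) • φ ∈ π.W') ∧
      (∀ (z : ideleGroup E) (hz : toNormOne F E c hc z ∈ π.scalarSubgroup),
        ψ z = ω ⟨toNormOne F E c hc z, hz⟩) ∧
      (∀ (X : (quasiSplitDatum F E c 1 hcpt).arch.lie), ∀ φ ∈ π.W,
        lieDeriv (quasiSplitDatum F E c 1 hcpt).ofArch X φ - d X • φ ∈ π.W') ∧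
      (∀ Y : Matrix (Fin 1) (Fin 1) (mixedSpace E),
        ((ψ (Matrix.GeneralLinearGroup.det (GLn.ofInfinite 1 E (expGL Y))) : ℂˣ) : ℂ) =
          Complex.exp (d (archLog F E c hcpt hc Y))) ∧
      (∀ X : (quasiSplitDatum F E c 1 hcpt).arch.lie,
        (quasiSplitDatum F E c 1 hcpt).ofArch ((quasiSplitDatum F E c 1 hcpt).arch.expMem X) = 1 →
          Complex.exp (d X) = 1) := by
  obtain ⟨φ₀, hφ₀W, hφ₀W'⟩ := SetLike.exists_of_lt π.lt
  obtain ⟨ω, hω⟩ := π.exists_monoidHom_scalarSubgroup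
  have hφ₀form : IsAutomorphicForm (quasiSplitDatum F E c 1 hcpt) φ₀ := isAutomorphicForm_of_mem π.stable hφ₀W
  -- the infinitesimal character `d`, a real linear form
  choose d₀ hd₀ using π.exists_lieDeriv_sub_smul_mem_rank_one
  have hWsmooth : ∀ φ ∈ π.W, IsArchSmooth (quasiSplitDatum F E c 1 hcpt).ofArch φ :=
    fun φ h => π.stable.isArchSmooth h
  have hduniq : ∀ (X : (quasiSplitDatum F E c 1 hcpt).arch.lie) (a : ℂ),
      lieDeriv (quasiSplitDatum F E c 1 hcpt).ofArch X φ₀ - a • φ₀ ∈ π.W' → a = d₀ X :=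
    fun X a ha => eq_of_sub_smul_mem_of_not_mem ha (hd₀ X φ₀ hφ₀W) hφ₀W'
  let d : (quasiSplitDatum F E c 1 hcpt).arch.lie →ₗ[ℝ] ℂ :=
    { toFun := d₀
      map_add' := fun X Y => by
        refine (hduniq (X + Y) (d₀ X + d₀ Y) ?_).symm
        rw [IsArchSmooth.lieDeriv_add_left _ (hWsmooth φ₀ hφ₀W) X Y, add_smul]
        convert π.W'.add_mem (hd₀ X φ₀ hφ₀W) (hd₀ Y φ₀ hφ₀W) using 1
        abel
      map_smul' := fun r X => by
        refine (hduniq (r • X) (r • d₀ X) ?_).symm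
        rw [IsArchSmooth.lieDeriv_smul_left _ (hWsmooth φ₀ hφ₀W) r X]
        have h1 := π.W'.smul_mem (r : ℂ) (hd₀ X φ₀ hφ₀W)
        convert h1 using 1
        funext g
        simp only [Pi.sub_apply, Pi.smul_apply, smul_eq_mul, Complex.real_smul]
        ring }
  have hd : ∀ X, d X = d₀ X := fun X => rfl
  -- the one-parameter elements lie in the scalar subgroup, `ω(exp tX) = e^{t d(X)}`
  have hWexp : ∀ (X : (quasiSplitDatum F E c 1 hcpt).arch.lie) (t : ℝ), ∀ φ ∈ π.W,
      rightTranslation (quasiSplit F E c 1) ((quasiSplitDatum F E c 1 hcpt).ofArch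
        ((quasiSplitDatum F E c 1 hcpt).arch.expMem (t • X))) φ ∈ π.W :=
    fun X t φ hφ => π.stable.rightTranslation_ofArch_expMem_mem_rank_one X t hφ
  have hW'exp : ∀ (X : (quasiSplitDatum F E c 1 hcpt).arch.lie) (t : ℝ), ∀ φ ∈ π.W',
      rightTranslation (quasiSplit F E c 1) ((quasiSplitDatum F E c 1 hcpt).ofArch
        ((quasiSplitDatum F E c 1 hcpt).arch.expMem (t • X))) φ ∈ π.W' :=
    fun X t φ hφ => π.stable'.rightTranslation_ofArch_expMem_mem_rank_one X t hφ
  have hexpmem : ∀ (X : (quasiSplitDatum F E c 1 hcpt).arch.lie) (t : ℝ),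
      (quasiSplitDatum F E c 1 hcpt).ofArch ((quasiSplitDatum F E c 1 hcpt).arch.expMem (t • X)) ∈ π.scalarSubgroup := by
    intro X t
    obtain ⟨a, ha⟩ := π.exists_rightTranslation_ofArch_expMem_sub_smul_mem_rank_one X t
    refine π.mem_scalarSubgroup_of_actsByScalar ⟨hWexp X t, hW'exp X t, a, ha⟩ ?_ ?_
    · intro φ hφ; rw [ofArch_expMem_smul_inv]; exact hWexp X (-t) φ hφ
    · intro φ hφ; rw [ofArch_expMem_smul_inv]; exact hW'exp X (-t) φ hφ
  have hωexp : ∀ (X : (quasiSplitDatum F E c 1 hcpt).arch.lie) (t : ℝ),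
      ((ω ⟨_, hexpmem X t⟩ : ℂˣ) : ℂ) = Complex.exp (t * d X) := fun X t =>
    π.scalar_eq_of_sub_smul_mem hω (hexpmem X t) hφ₀W hφ₀W'
      (π.rightTranslation_ofArch_expMem_sub_exp_smul_mem_rank_one X (hd₀ X) t hφ₀W)
  -- `ψ₀`: extension of `ω ∘ toNormOne` from `toNormOne⁻¹(H_π)` to all idèles
  obtain ⟨ψ₀, hψ₀⟩ := MonoidHom.exists_extend_unitsComplex (π.scalarSubgroup.comap (toNormOne F E c hc))
    (ω.comp ((toNormOne F E c hc).subgroupComap π.scalarSubgroup))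
  have hψ₀val : ∀ (z : ideleGroup E) (hz : toNormOne F E c hc z ∈ π.scalarSubgroup),
      ψ₀ z = ω ⟨toNormOne F E c hc z, hz⟩ := fun z hz => hψ₀ ⟨z, hz⟩
  -- the archimedean link `ψ₀(det (exp Y, 1)) = e^{d(Y - (c ⊗ 1)Y)}`
  have hlink : ∀ Y : Matrix (Fin 1) (Fin 1) (mixedSpace E),
      ((ψ₀ (Matrix.GeneralLinearGroup.det (GLn.ofInfinite 1 E (expGL Y))) : ℂˣ) : ℂ) =
        Complex.exp (d (archLog F E c hcpt hc Y)) := by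
    intro Y
    have h1 : toNormOne F E c hc (Matrix.GeneralLinearGroup.det (GLn.ofInfinite 1 E (expGL Y))) =
        (quasiSplitDatum F E c 1 hcpt).ofArch ((quasiSplitDatum F E c 1 hcpt).arch.expMem
          ((1 : ℝ) • archLog F E c hcpt hc Y)) := by
      rw [one_smul]; exact toNormOne_det_ofInfinite_expGL hc Y
    have hmem : toNormOne F E c hc (Matrix.GeneralLinearGroup.det (GLn.ofInfinite 1 E (expGL Y))) ∈
        π.scalarSubgroup := by rw [h1]; exact hexpmem _ 1
    rw [hψ₀val _ hmem]
    have h2 : (⟨_, hmem⟩ : π.scalarSubgroup) = ⟨_, hexpmem (archLog F E c hcpt hc Y) 1⟩ := Subtype.ext h1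
    rw [h2, hωexp, Complex.ofReal_one, one_mul]
  -- `ψ₀ = 1` on the finite idèles `det (1, u)`, `u ∈ U₀ = U₁ ∩ c⁻¹(U₁)`, `U₁` the level of `φ₀`
  obtain ⟨U, hU, hφ₀U⟩ := hφ₀form.exists_level
  obtain ⟨U₁, hU₁o, hU₁c, rfl⟩ := hU
  set cF : GL (Fin 1) (FiniteAdeleRing (𝓞 E) E) →* GL (Fin 1) (FiniteAdeleRing (𝓞 E) E) :=
    Matrix.GeneralLinearGroup.map (MulSemiringAction.toRingHom (E ≃ₐ[F] E) (FiniteAdeleRing (𝓞 E) E) c) with hcF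
  have hcFcont : Continuous cF := (FiniteAdeleRing.continuous_smul E c).generalLinearGroup_map
  have hU₀o : IsOpen ((U₁ ⊓ U₁.comap cF : Subgroup (GL (Fin 1) (FiniteAdeleRing (𝓞 E) E))) :
      Set (GL (Fin 1) (FiniteAdeleRing (𝓞 E) E))) := hU₁o.inter (hU₁o.preimage hcFcont)
  have hψ₀U : ∀ u ∈ U₁ ⊓ U₁.comap cF, ψ₀ (Matrix.GeneralLinearGroup.det (GLn.ofFinite 1 E u)) = 1 := by
    intro u hu
    obtain ⟨hu₁, hu₂⟩ := Subgroup.mem_inf.1 hu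
    set z := Matrix.GeneralLinearGroup.det (GLn.ofFinite 1 E u) with hz
    have hmemU : toNormOne F E c hc z ∈ (U₁.map (GLn.ofFinite 1 E)).comap
        (adelic F E c 1 ((StdForm.antidiagonal 1).over E)).subtype :=
      ⟨u * (cF u)⁻¹, U₁.mul_mem hu₁ (U₁.inv_mem hu₂), (adelicVal_toNormOne_det_ofFinite hc u).symm⟩
    have hfix : rightTranslation (quasiSplit F E c 1) (toNormOne F E c hc z) φ₀ = φ₀ :=
      funext fun g => hφ₀U _ hmemU g
    have hfin : toNormOne F E c hc z ∈ (quasiSplitDatum F E c 1 hcpt).finiteAdelic :=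
      (quasiSplitDatum F E c 1 hcpt).le_finiteAdelic _ ⟨U₁, hU₁o, hU₁c, rfl⟩ hmemU
    have h₀ : rightTranslation (quasiSplit F E c 1) (toNormOne F E c hc z) φ₀ - (1 : ℂ) • φ₀ ∈ π.W' := by
      rw [hfix, one_smul, sub_self]; exact π.W'.zero_mem
    have hmem : toNormOne F E c hc z ∈ π.scalarSubgroup := mem_scalarSubgroup_of_mem_finiteAdelic π hfin hφ₀W hφ₀W' h₀
    rw [hψ₀val z hmem]
    exact Units.ext (π.scalar_eq_of_sub_smul_mem hω hmem hφ₀W hφ₀W' h₀)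
  -- continuity of `g ↦ ψ₀(det g)` on `GL₁(𝔸_E)`, hence of `ψ₀`
  have hccont : Continuous fun g : GL (Fin 1) (AdeleRing (𝓞 E) E) =>
      ((ψ₀ (Matrix.GeneralLinearGroup.det g) : ℂˣ) : ℂ) := by
    refine continuous_iff_continuousAt.2 fun g₀ => ?_
    refine continuousAt_of_continuousAt_archSlice (n := 1) (K := E) hU₀o (fun u hu g => ?_) g₀ ?_
    · obtain ⟨u₀, hu₀, rfl⟩ := Subgroup.mem_map.1 hu
      change ((ψ₀ (Matrix.GeneralLinearGroup.det (g * GLn.ofFinite 1 E u₀)) : ℂˣ) : ℂ) =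
        ((ψ₀ (Matrix.GeneralLinearGroup.det g) : ℂˣ) : ℂ)
      rw [map_mul, map_mul, hψ₀U u₀ hu₀, mul_one]
    · have hslice : (fun Y : Matrix (Fin 1) (Fin 1) (mixedSpace E) =>
          ((ψ₀ (Matrix.GeneralLinearGroup.det (g₀ * GLn.ofInfinite 1 E (expGL Y))) : ℂˣ) : ℂ)) =
          fun Y => ((ψ₀ (Matrix.GeneralLinearGroup.det g₀) : ℂˣ) : ℂ) * Complex.exp (d (archLog F E c hcpt hc Y)) := by
        funext Y
        rw [map_mul, map_mul, Units.val_mul, hlink]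
      rw [hslice]
      exact (continuous_const.mul (Complex.continuous_exp.comp
        (d ∘ₗ archLog F E c hcpt hc).continuous_of_finiteDimensional)).continuousAt
  have hψcont : Continuous ψ₀ := by
    have h1 : Continuous fun x : ideleGroup E => ((ψ₀ x : ℂˣ) : ℂ) := by
      refine (hccont.comp (continuous_generalLinearGroup_scalar (R := AdeleRing (𝓞 E) E) (Fin 1))).congr
        fun x => ?_
      simp only [Function.comp_apply, det_generalLinearGroup_scalar_fin_one]
    refine Units.continuous_iff.2 ⟨h1, ?_⟩
    have h2 : Continuous fun x : ideleGroup E => ((ψ₀ x : ℂˣ) : ℂ)⁻¹ := h1.inv₀ fun x => (ψ₀ x).ne_zero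
    convert h2 using 1
    funext x
    exact Units.val_inv_eq_inv_val _
  -- triviality on principal idèles
  have hprinc : ∀ x ∈ principalIdeles E, ψ₀ x = 1 := by
    rintro _ ⟨x, rfl⟩
    have harith := toNormOne_principal_mem_arithmeticSubgroup (F := F) hc x
    set γ := toNormOne F E c hc (Units.map (algebraMap E (AdeleRing (𝓞 E) E) : E →* AdeleRing (𝓞 E) E) x) with hγ
    have hfixall : ∀ φ ∈ π.W, rightTranslation (quasiSplit F E c 1) γ φ = φ := by
      intro φ hφ
      funext g
      rw [rightTranslation_apply, mul_comm_rank_one F E c g γ]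
      exact (isAutomorphicForm_of_mem π.stable hφ).leftInvariant γ harith g
    have hmem : γ ∈ π.scalarSubgroup := π.mem_scalarSubgroup_of_forall_eq hfixall
    rw [hψ₀val _ hmem]
    refine Units.ext (π.scalar_eq_of_sub_smul_mem hω hmem hφ₀W hφ₀W' ?_)
    rw [hfixall φ₀ hφ₀W, Units.val_one, one_smul, sub_self]
    exact π.W'.zero_mem
  let ψ : HeckeCharacter E := ⟨⟨ψ₀, hψcont⟩, hprinc⟩
  refine ⟨ω, ψ, d, hω, fun z hz => hψ₀val z hz, fun X => hd₀ X, hlink, fun X hX => ?_⟩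
  -- periodicity: `exp X = 1` forces `e^{d X} = 1`
  have h1 : (quasiSplitDatum F E c 1 hcpt).ofArch ((quasiSplitDatum F E c 1 hcpt).arch.expMem ((1 : ℝ) • X)) = 1 := by
    rw [one_smul]; exact hX
  have h2 : (⟨_, hexpmem X 1⟩ : π.scalarSubgroup) = 1 := Subtype.ext h1
  have h3 := hωexp X 1
  rw [h2, map_one, Units.val_one, Complex.ofReal_one, one_mul] at h3
  exact h3.symm

end UnitaryGroup

/-! ### Consequences: algebraicity, values at good split places, and Weil's theorem -/

namespace UnitaryGroup

open Literature.NumberTheory.GaloisRepresentations (HeckeCharacter)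
open scoped ComplexConjugate

variable {F E : Type} [Field F] [NumberField F] [Field E] [NumberField E] [Algebra F E]
  {c : E ≃ₐ[F] E} {hcpt : isCompact_glFiniteIntegralLevel 1 E}

/-- **A quadratic extension with a non-trivial automorphism is Galois, and that automorphism fixes
every complex place above a real place**: for `[E : F] = 2`, `c ≠ 1`, `F` totally real and `w` a
complex place of `E`, `c • w = w` (`w` is ramified over `F`, so its stabiliser has order
`2 = |Gal(E/F)|`; Mathlib `isRamified_iff_card_stabilizer_eq_two`). [folklore] -/
theorem smul_infinitePlace_eq_of_isComplex (h2 : Module.finrank F E = 2) (hc1 : c ≠ 1)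
    (hF : IsTotallyReal F) (w : InfinitePlace E) (hw : w.IsComplex) : c • w = w := by
  haveI : FiniteDimensional F E := Module.finite_of_finrank_eq_succ h2
  have hcard : Fintype.card (E ≃ₐ[F] E) = Module.finrank F E := by
    refine le_antisymm AlgEquiv.card_le ?_
    rw [h2]
    exact Fintype.one_lt_card_iff_nontrivial.2 ⟨⟨c, 1, hc1⟩⟩
  haveI : IsGalois F E := IsGalois.of_card_aut_eq_finrank F E (by rw [Nat.card_eq_fintype_card, hcard])
  have hram : w.IsRamified F := InfinitePlace.isRamified_iff.2 ⟨hw, hF.isReal _⟩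
  have hstab : Nat.card (MulAction.stabilizer (E ≃ₐ[F] E) w) = Nat.card (E ≃ₐ[F] E) := by
    rw [InfinitePlace.isRamified_iff_card_stabilizer_eq_two.1 hram, Nat.card_eq_fintype_card, hcard, h2]
  have htop := Subgroup.eq_top_of_card_eq _ hstab
  have hmem : c ∈ MulAction.stabilizer (E ≃ₐ[F] E) w := by rw [htop]; exact Subgroup.mem_top c
  exact hmem

/-- `(a · 1).map conj`-free form of `archLog` on a complex factor, as an element of `𝔲(1)`:
`archLog (a · 1_w) = (Im a / π) • archLog (πi · 1_w)`. [folklore] -/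
theorem archLog_complexPlaceLie_eq_smul (hc : c * c = 1) {w : {w : InfinitePlace E // w.IsComplex}}
    (hw : c • w.1 = w.1) (hc1 : c ≠ 1) (a : ℂ) :
    archLog F E c hcpt hc (complexPlaceLie 1 w (a • (1 : Matrix (Fin 1) (Fin 1) ℂ))) =
      (a.im / Real.pi) • archLog F E c hcpt hc
        (complexPlaceLie 1 w (((Real.pi : ℂ) * Complex.I) • (1 : Matrix (Fin 1) (Fin 1) ℂ))) := by
  apply Subtype.ext
  change _ = (a.im / Real.pi) • ((archLog F E c hcpt hc
    (complexPlaceLie 1 w (((Real.pi : ℂ) * Complex.I) • (1 : Matrix (Fin 1) (Fin 1) ℂ))) :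
      (quasiSplitDatum F E c 1 hcpt).arch.lie) : Matrix (Fin 1) (Fin 1) (mixedSpace E))
  rw [coe_archLog_complexPlaceLie hc hw hc1, coe_archLog_complexPlaceLie hc hw hc1,
    ← map_smul (complexPlaceLie 1 w), ← smul_assoc, Complex.real_smul]
  congr 2
  rw [Complex.sub_conj, Complex.sub_conj, Complex.mul_im, Complex.ofReal_re, Complex.ofReal_im,
    Complex.I_re, Complex.I_im]
  push_cast
  field_simp
  ring

/-- **The Hecke character of an automorphic representation of `U(1)_{E/F}` is algebraic** (of type
`A₀`), when `E` is totally complex and `c ≠ 1` fixes every complex place (e.g. `E/F` CM): with the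
infinitesimal character `d` and the link `ψ(det(exp Y, 1)) = e^{d(Y - (c ⊗ 1)Y)}`, periodicity
`e^{d(archLog(πi · 1_w))} = 1` gives integers `n_w` with `d(archLog(a · 1_w)) = n_w (a - ā)`, so
`ψ((x, 1)) = ∏_w ι_w(x_w)^{n_w} \overline{ι_w(x_w)}^{-n_w}` for all `x ∈ (E ⊗ ℝ)ˣ` (infinity type
`(p, q) = (-n, n)`). Weil 1956, §1 (type `A₀`); Rogawski 1990, §11.3; this is why automorphic forms
on the compact-at-infinity torus `U(1)` are algebraic. [cite: Weil1956, §1] -/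
theorem heckeCharacter_isAlgebraic_rank_one (hc : c * c = 1) (hE : IsTotallyComplex E)
    (hfix : ∀ w : {w : InfinitePlace E // w.IsComplex}, c • w.1 = w.1) (hc1 : c ≠ 1)
    {ψ : HeckeCharacter E} {d : (quasiSplitDatum F E c 1 hcpt).arch.lie →ₗ[ℝ] ℂ}
    (hlink : ∀ Y : Matrix (Fin 1) (Fin 1) (mixedSpace E),
      ((ψ (Matrix.GeneralLinearGroup.det (GLn.ofInfinite 1 E (expGL Y))) : ℂˣ) : ℂ) =
        Complex.exp (d (archLog F E c hcpt hc Y)))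
    (hper : ∀ X : (quasiSplitDatum F E c 1 hcpt).arch.lie,
      (quasiSplitDatum F E c 1 hcpt).ofArch ((quasiSplitDatum F E c 1 hcpt).arch.expMem X) = 1 →
        Complex.exp (d X) = 1) :
    ψ.IsAlgebraic := by
  -- the integers `n w`
  have hn : ∀ w : {w : InfinitePlace E // w.IsComplex}, ∃ n : ℤ,
      d (archLog F E c hcpt hc (complexPlaceLie 1 w (((Real.pi : ℂ) * Complex.I) • (1 : Matrix (Fin 1) (Fin 1) ℂ)))) =
        n * (2 * Real.pi * Complex.I) := fun w =>
    Complex.exp_eq_one_iff.1 (hper _ (ofArch_expMem_archLog_pi_I hc (hfix w) hc1))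
  choose n hn using hn
  -- `d (archLog (a · 1_w)) = n_w (a - ā)`
  have hda : ∀ (w : {w : InfinitePlace E // w.IsComplex}) (a : ℂ),
      d (archLog F E c hcpt hc (complexPlaceLie 1 w (a • (1 : Matrix (Fin 1) (Fin 1) ℂ)))) = n w * (a - conj a) := by
    intro w a
    rw [archLog_complexPlaceLie_eq_smul hc (hfix w) hc1, map_smul d, hn w, Complex.real_smul, Complex.sub_conj]
    push_cast
    field_simp
  have hexpC : ∀ (w : {w : InfinitePlace E // w.IsComplex}) (a : ℂ),
      Complex.exp (d (archLog F E c hcpt hc (complexPlaceLie 1 w (a • (1 : Matrix (Fin 1) (Fin 1) ℂ))))) =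
        Complex.exp a ^ n w * Complex.exp (conj a) ^ (-n w) := by
    intro w a
    rw [hda, mul_sub, sub_eq_add_neg, ← neg_mul, Complex.exp_add, Complex.exp_int_mul, ← Int.cast_neg,
      Complex.exp_int_mul]
  -- no real places
  haveI : IsEmpty {w : InfinitePlace E // w.IsReal} :=
    ⟨fun w => (InfinitePlace.not_isReal_iff_isComplex.2 (hE.isComplex w.1)) w.2⟩
  refine (ψ.isAlgebraic_iff_exists_hasInfinityType).2
    ⟨fun w => if hw : w.IsComplex then -n ⟨w, hw⟩ else 0, fun w => if hw : w.IsComplex then n ⟨w, hw⟩ else 0,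
      Set.univ, Filter.univ_mem, fun x _ => ?_⟩
  -- the coordinatewise logarithm `y` of `x` and `Y = y · 1 ∈ 𝔤𝔩₁(E_∞)`
  obtain ⟨y, hy2⟩ : ∃ y : mixedSpace E, ∀ w : {w : InfinitePlace E // w.IsComplex},
      y.2 w = Complex.log (InfinitePlace.Completion.extensionEmbedding w.1 ((x : InfiniteAdeleRing E) w.1)) :=
    ⟨(fun _ => 0, fun w => Complex.log (InfinitePlace.Completion.extensionEmbedding w.1 ((x : InfiniteAdeleRing E) w.1))),
      fun _ => rfl⟩
  have hY00 : (y • (1 : Matrix (Fin 1) (Fin 1) (mixedSpace E))) 0 0 = y := by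
    rw [Matrix.smul_apply, Matrix.one_apply_eq, smul_eq_mul, mul_one]
  -- `(x, 1) = det (exp Y, 1)` as idèles
  have hxY : infiniteIdeles E x = Matrix.GeneralLinearGroup.det
      (GLn.ofInfinite 1 E (expGL (y • (1 : Matrix (Fin 1) (Fin 1) (mixedSpace E))))) := by
    refine idele_eq_of_snd_eq_of_extensionEmbedding_eq E ?_ fun w => ?_
    · rw [det_ofInfinite_snd]
      rfl
    · rw [extensionEmbedding_det_ofInfinite_expGL, hY00,
        Literature.NumberTheory.GaloisRepresentations.infiniteIdeles_fst]
      by_cases hw : w.IsReal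
      · exact absurd hw (InfinitePlace.not_isReal_iff_isComplex.2 (hE.isComplex w))
      · rw [dif_neg hw, hy2 ⟨w, InfinitePlace.not_isReal_iff_isComplex.1 hw⟩,
          Complex.exp_log (Literature.NumberTheory.GaloisRepresentations.InfiniteIdele.extensionEmbedding_apply_ne_zero x w)]
  have hcomp : ∀ Y, d (archLog F E c hcpt hc Y) = (d ∘ₗ archLog F E c hcpt hc) Y := fun Y => rfl
  rw [hxY, hlink, hcomp, linearMap_smul_one_eq_sum (d ∘ₗ archLog F E c hcpt hc) y, Complex.exp_add,
    Complex.exp_sum, Complex.exp_sum, HeckeCharacter.archFactor_apply, InfinitePlace.prod_eq_prod_mul_prod]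
  congr 1
  · rw [Finset.univ_eq_empty, Finset.prod_empty, Finset.prod_empty]
  · refine Finset.prod_congr rfl fun w _ => ?_
    rw [← hcomp, hexpC, dif_pos w.2, dif_pos w.2, neg_neg, hy2 w, Complex.exp_conj,
      Complex.exp_log (Literature.NumberTheory.GaloisRepresentations.InfiniteIdele.extensionEmbedding_apply_ne_zero x w.1)]

/-- **The Hecke character reads the base-change Satake parameters at the good split places.** Let `ψ`
be the Hecke character of `π` (`ψ z = ω(z/c(z))` on `toNormOne⁻¹(H_π)`). If `π` has base-change Satake
parameter `α` at a finite place `u` of `E` with `c • u ≠ u` (i.e. the place of `F` below `u`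
splits), then `ψ` is unramified at `u` and `α = {ψ(ϖ_u)}`: the elements `toNormOne (x at u)` are
finite, supported over the place below `u`, lie in the level `K_U(𝔫)` for `x ∈ 𝒪_uˣ`, and act on the
eigenform of the Satake witness by `b^{ord_u x}` (`HasBaseChangeSatakeAt.rank_one`). Mok 2014,
§2.1–2.2 with Thm. 2.5.1 (`N = 1`); Mínguez 2011, Thm. 4.1. [cite: Mok2014, Thm. 2.5.1] -/
theorem isUnramifiedAt_and_eq_valueAtUniformizer_of_hasBaseChangeSatakeAt (hc : c * c = 1)
    {π : AutomorphicRepData (quasiSplitDatum F E c 1 hcpt)} {ω : π.scalarSubgroup →* ℂˣ}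
    (hω : ∀ (g : π.scalarSubgroup), ∀ φ ∈ π.W,
      rightTranslation (quasiSplit F E c 1) (g : (quasiSplit F E c 1).Adelic) φ - ((ω g : ℂˣ) : ℂ) • φ ∈ π.W')
    {ψ : HeckeCharacter E}
    (hψ : ∀ (z : ideleGroup E) (hz : toNormOne F E c hc z ∈ π.scalarSubgroup), ψ z = ω ⟨toNormOne F E c hc z, hz⟩)
    {u : HeightOneSpectrum (𝓞 E)} (hu : c • u ≠ u) {α : Multiset ℂ}
    (hα : HasBaseChangeSatakeAt F E c 1 hcpt π u α) :
    ψ.IsUnramifiedAt u ∧ α = {ψ.valueAtUniformizer u} := by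
  obtain ⟨b, 𝔫, rfl, -, -, h𝔫, hu𝔫, hcu𝔫, φ, hφW, hφW', hfix, heig⟩ := hα.rank_one
  have hval : ∀ (x : (u.adicCompletion E)ˣ) (a : ℂ),
      rightTranslation (quasiSplit F E c 1) (toNormOne F E c hc (localUnits u x)) φ - a • φ ∈ π.W' →
        ((ψ (localUnits u x) : ℂˣ) : ℂ) = a := by
    intro x a hx
    have hmem : toNormOne F E c hc (localUnits u x) ∈ π.scalarSubgroup :=
      mem_scalarSubgroup_of_mem_finiteAdelic π (toNormOne_localUnits_mem_finiteAdelic u x) hφW hφW' hx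
    rw [hψ _ hmem]
    exact π.scalar_eq_of_sub_smul_mem hω hmem hφW hφW' hx
  refine ⟨fun x => Units.ext ?_, ?_⟩
  · rw [HeckeCharacter.localComponent_apply, Units.val_one]
    refine hval _ 1 ?_
    rw [hfix _ (toNormOne_localUnits_mem_level h𝔫 hu𝔫 hcu𝔫 x), one_smul, sub_self]
    exact π.W'.zero_mem
  · rw [Multiset.singleton_inj, HeckeCharacter.valueAtUniformizer, HeckeCharacter.localComponent_apply]
    refine (hval _ b ?_).symm
    have h := heig (toNormOne F E c hc (localUnits u (HeckeCharacter.uniformizer E u)))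
      (isSupportedAt_toNormOne_localUnits (hc := hc) u (HeckeCharacter.uniformizer E u))
    rwa [diagOrd_toNormOne_localUnits hu, HeckeCharacter.valued_uniformizer, WithZero.log_exp, neg_neg,
      zpow_one] at h

end UnitaryGroup

/-! ### The fact in rank one -/

section RankOne

open scoped Polynomial
open Polynomial UnitaryGroup
open Literature.NumberTheory.GaloisRepresentations (HeckeCharacter)

/-- An automorphism of a quadratic extension is an involution (`|Aut(E/F)| ≤ [E : F] = 2`); the
tree's `AlgEquiv.mul_self_eq_one_of_finrank_eq_two` (`AsaiSign`), re-proved to keep the imports of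
this file inside the unitary/Hecke-character stack. [folklore] -/
theorem algEquiv_mul_self_eq_one_of_finrank_eq_two {F₀ K : Type} [Field F₀] [Field K] [Algebra F₀ K]
    (h2 : Module.finrank F₀ K = 2) (c : K ≃ₐ[F₀] K) : c * c = 1 := by
  haveI : FiniteDimensional F₀ K := Module.finite_of_finrank_eq_succ h2
  have hcard : Fintype.card (K ≃ₐ[F₀] K) ≤ 2 := h2 ▸ AlgEquiv.card_le
  have hpow : c ^ Fintype.card (K ≃ₐ[F₀] K) = 1 := pow_card_eq_one
  have hpos : 0 < Fintype.card (K ≃ₐ[F₀] K) := Fintype.card_pos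
  interval_cases h : Fintype.card (K ≃ₐ[F₀] K)
  · rw [pow_one] at hpow; rw [hpow, one_mul]
  · rw [← sq, hpow]

/-- Coefficients of `X - C b⁻¹` lie in any subfield containing `b`. [folklore] -/
theorem coeff_X_sub_C_inv_mem (L : IntermediateField ℚ ℂ) {b : ℂ} (hb : b ∈ L) (k : ℕ) :
    (X - C b⁻¹ : ℂ[X]).coeff k ∈ L := by
  rw [Polynomial.coeff_sub, Polynomial.coeff_X, Polynomial.coeff_C]
  refine sub_mem ?_ ?_
  · split_ifs
    · exact one_mem L
    · exact zero_mem L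
  · split_ifs
    · exact inv_mem hb
    · exact zero_mem L

/-- **Goldring–Koskivirta 2019, Thm. 10.5.1 in rank `N = 1` — the `N = 1` slice of
`GoldringKoskivirta2019_heckeFieldFinite`, verbatim, PROVED.** For Mok's torus `U_{K/F₀}(1)` (the
`0`-dimensional unitary Shimura variety) the statement is Weil's theorem for the Hecke character
`ψ_σ` of `σ` (`AutomorphicRepData.exists_heckeCharacter_rank_one`): `ψ_σ` is algebraic
(`heckeCharacter_isAlgebraic_rank_one`: `K` totally complex, and `c_K` fixes every complex place,
`smul_infinitePlace_eq_of_isComplex`), so all its values at unramified places lie in one number field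
`L ⊂ ℂ` (Weil 1956, the tree's `HeckeCharacter.IsAlgebraic.exists_intermediateField_valueAtUniformizer_mem`);
at a good place `u` the base-change Satake parameter is `{ψ_σ(ϖ_u)}` if the place below `u` splits
(`isUnramifiedAt_and_eq_valueAtUniformizer_of_hasBaseChangeSatakeAt`) and `{1}` if it is inert
(`HasBaseChangeSatakeAt.rank_one`), so the predicted polynomial `X - b⁻¹` has coefficients in `L`,
and `exists_finiteDimensional_coeff_arithFrobPolyOfSatake_mem` passes to one finite `E/ℚ_ℓ`. The
hypotheses at `∞` (limits of discrete series) and at `ℓ` are not needed in rank one.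
[cite: GoldringKoskivirta2019, Thm. 10.5.1 and §11.1 (arXiv:1507.05032 p. 40), case N = 1]
[cite: Weil1956, §1] -/
theorem GoldringKoskivirta2019_heckeFieldFinite_rank_one
    (F₀ K : Type) [Field F₀] [NumberField F₀] [Field K] [NumberField K] [Algebra F₀ K]
    (cK : K ≃ₐ[F₀] K) (hF₀ : IsTotallyReal F₀) (h2 : Module.finrank F₀ K = 2) (hc : cK ≠ 1)
    (hK : IsTotallyComplex K) (ℓ : ℕ) [Fact ℓ.Prime] (ι : PadicAlgCl ℓ ≃+* ℂ)
    (hcptK : isCompact_glFiniteIntegralLevel 1 K)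
    (σ : UnitaryGroup.CuspidalAutomorphicRepData F₀ K cK 1 hcptK)
    (_hLDS : ∀ (w : {w : InfinitePlace K // w.IsComplex}) (hw : cK • w.1 = w.1),
      ∃ (p q : ℕ) (d : LDSDatum p q),
        UnitaryGroup.IsNondegenerateLimitOfDiscreteSeriesAt F₀ K cK 1 (StdForm.antidiagonal 1)
          hcptK σ.1 hw hc d)
    (_hℓ : ∀ u : HeightOneSpectrum (𝓞 K), ((ℓ : ℕ) : 𝓞 K) ∈ u.asIdeal →
      u.asIdeal.ramificationIdx ℤ = 1 ∧ UnitaryGroup.IsUnramifiedAt F₀ K cK 1 hcptK σ.1 u) :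
    ∃ E : IntermediateField ℚ_[ℓ] (PadicAlgCl ℓ), FiniteDimensional ℚ_[ℓ] E ∧
      ∀ (u : HeightOneSpectrum (𝓞 K)) (β : Multiset ℂ), ((ℓ : ℕ) : 𝓞 K) ∉ u.asIdeal →
        (∀ u' : HeightOneSpectrum (𝓞 K), u'.asIdeal.under ℤ = u.asIdeal.under ℤ →
          u'.asIdeal.ramificationIdx ℤ = 1 ∧ UnitaryGroup.IsUnramifiedAt F₀ K cK 1 hcptK σ.1 u') →
        UnitaryGroup.HasBaseChangeSatakeAt F₀ K cK 1 hcptK σ.1 u β →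
          ∀ k : ℕ, (arithFrobPolyOfSatake ι u.residueCard 1 β).coeff k ∈ E := by
  have hc2 : cK * cK = 1 := algEquiv_mul_self_eq_one_of_finrank_eq_two h2 cK
  have hfix : ∀ w : {w : InfinitePlace K // w.IsComplex}, cK • w.1 = w.1 :=
    fun w => smul_infinitePlace_eq_of_isComplex h2 hc hF₀ w.1 w.2
  obtain ⟨ω, ψ, d, hω, hψ, -, hlink, hper⟩ := σ.1.exists_heckeCharacter_rank_one hc2
  have halg : ψ.IsAlgebraic := heckeCharacter_isAlgebraic_rank_one hc2 hK hfix hc hlink hper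
  obtain ⟨L, hLfd, -, hLval⟩ := halg.exists_intermediateField_valueAtUniformizer_mem
  haveI := hLfd
  obtain ⟨E', hfd, hE'⟩ := exists_finiteDimensional_coeff_arithFrobPolyOfSatake_mem ι L
  refine ⟨E', hfd, fun u β _ _ hβ => hE' _ _ _ fun k => ?_⟩
  -- the complex predicted polynomial is `X - C b⁻¹` with `b ∈ L`
  have hb : ∃ b : ℂ, β = {b} ∧ b ∈ L := by
    by_cases hu : cK • u = u
    · obtain ⟨b, 𝔫, hβb, -, hb1, -⟩ := hβ.rank_one
      exact ⟨b, hβb, by rw [hb1 hu]; exact one_mem L⟩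
    · obtain ⟨hunr, hβψ⟩ := isUnramifiedAt_and_eq_valueAtUniformizer_of_hasBaseChangeSatakeAt hc2 hω hψ hu hβ
      exact ⟨_, hβψ, hLval u hunr⟩
  obtain ⟨b, rfl, hbL⟩ := hb
  rw [Multiset.map_singleton, Multiset.prod_singleton, Nat.sub_self, pow_zero, one_mul]
  exact coeff_X_sub_C_inv_mem L hbL k

end RankOne

/-! ## Reduction of a discharge to rank `N ≥ 2` -/

section TwoLeRank

open scoped Polynomial
open Polynomial UnitaryGroup

/-- **Reduction of a discharge to rank at least two.** `GoldringKoskivirta2019_heckeFieldFinite`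
quantifies over every `N : ℕ`; its cases `N = 0` (`GoldringKoskivirta2019_heckeFieldFinite_rank_zero`:
a base-change Satake parameter has no entries) and `N = 1`
(`GoldringKoskivirta2019_heckeFieldFinite_rank_one`: Weil's theorem for the Hecke character of `σ` on
the norm-one torus `U_{K/F₀}(1)`, the `0`-dimensional unitary Shimura variety) are PROVED, so the
fact follows from its own restriction to `2 ≤ N` — the range in which the unitary Shimura variety of
Goldring–Koskivirta, Thm. 3.5.5 / §11.1 has positive dimension and the printed input (Cor. 2.2.2:
the Hecke eigensystem of `σ` is realised in the integral coherent cohomology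
`H^i(Sh^tor_𝒦, 𝒱_η^sub)`, a finitely generated `𝒪_𝔭`-module; the hypothesis `hreal` of
`GoldringKoskivirta2019_heckeFieldFinite_of_padicRealisation`) is genuinely geometric. (A `theorem`
with the restricted statement as hypothesis, as `GoldringKoskivirta2019_heckeFieldFinite_of_pos_rank`;
no new named fact.) [folklore] -/
theorem GoldringKoskivirta2019_heckeFieldFinite_of_two_le_rank
    (h : ∀ (F₀ K : Type) [Field F₀] [NumberField F₀] [Field K] [NumberField K] [Algebra F₀ K]
      (cK : K ≃ₐ[F₀] K), IsTotallyReal F₀ → Module.finrank F₀ K = 2 → ∀ (hc : cK ≠ 1),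
      IsTotallyComplex K → ∀ (N : ℕ), 2 ≤ N → ∀ (ℓ : ℕ) [Fact ℓ.Prime] (ι : PadicAlgCl ℓ ≃+* ℂ)
      (hcptK : isCompact_glFiniteIntegralLevel N K)
      (σ : UnitaryGroup.CuspidalAutomorphicRepData F₀ K cK N hcptK),
      (∀ (w : {w : InfinitePlace K // w.IsComplex}) (hw : cK • w.1 = w.1),
        ∃ (p q : ℕ) (d : LDSDatum p q),
          UnitaryGroup.IsNondegenerateLimitOfDiscreteSeriesAt F₀ K cK N (StdForm.antidiagonal N)
            hcptK σ.1 hw hc d) →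
      (∀ u : HeightOneSpectrum (𝓞 K), ((ℓ : ℕ) : 𝓞 K) ∈ u.asIdeal →
        u.asIdeal.ramificationIdx ℤ = 1 ∧ UnitaryGroup.IsUnramifiedAt F₀ K cK N hcptK σ.1 u) →
      ∃ E : IntermediateField ℚ_[ℓ] (PadicAlgCl ℓ), FiniteDimensional ℚ_[ℓ] E ∧
        ∀ (u : HeightOneSpectrum (𝓞 K)) (β : Multiset ℂ), ((ℓ : ℕ) : 𝓞 K) ∉ u.asIdeal →
          (∀ u' : HeightOneSpectrum (𝓞 K), u'.asIdeal.under ℤ = u.asIdeal.under ℤ →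
            u'.asIdeal.ramificationIdx ℤ = 1 ∧
              UnitaryGroup.IsUnramifiedAt F₀ K cK N hcptK σ.1 u') →
          UnitaryGroup.HasBaseChangeSatakeAt F₀ K cK N hcptK σ.1 u β →
            ∀ k : ℕ, (arithFrobPolyOfSatake ι u.residueCard N β).coeff k ∈ E) :
    GoldringKoskivirta2019_heckeFieldFinite := by
  refine GoldringKoskivirta2019_heckeFieldFinite_of_pos_rank ?_
  intro F₀ K _ _ _ _ _ cK hF₀ hK hc hKc N hN
  obtain _ | _ | N := N
  · exact absurd hN (lt_irrefl 0)
  · intro ℓ _ ι hcptK σ hLDS hℓ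
    exact GoldringKoskivirta2019_heckeFieldFinite_rank_one F₀ K cK hF₀ hK hc hKc ℓ ι hcptK σ hLDS hℓ
  · exact h F₀ K cK hF₀ hK hc hKc (N + 2) (Nat.le_add_left 2 N)

end TwoLeRank

end Literature.NumberTheory.Automorphic
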